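import Literature.MathematicalPhysics.QuantumFieldTheory.Balaban1983to89.B7Prop8Flat
import Literature.MathematicalPhysics.QuantumFieldTheory.Balaban1983to89.B7Eq38Remainder

/-!
# B7 Proposition 9 at the flat background: the averaged perturbation (178)–(179) and the one-step bounds
(180)–(200) (`B7Prop9Flat`)

Source: T. Bałaban, *Averaging operations for lattice gauge theories*, Commun. Math. Phys. **98** (1985) 17–51
(`Balaban1985Averaging`, "B7"), Sect. F, pp. 45–49 (renders `1985-cmp98-averaging-p029`–`p033-x2.png`, READ AS IMAGES by the
typing seat; journal page = render page + 16), with (31), (39), (41) p. 22–23 (render p006/p007) and (78)–(80) p. 30.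

PRINT (verbatim, pp. 45–49; re-read against the renders for v1.0.1 — v1 carried a paraphrase of p. 45 and of (180)/(185) taken from the
lineage transcript; the displays themselves were correct). p. 45: "We will need to consider regular configurations `u′` in the sense
that the following conditions are satisfied: `|u′(x) − 1| < α₄, x ∈ Ω`, (176) `|u′⁻¹(b₋)R_{0,b}u′(b₊) − 1| < α₄η, b ⊂ Ω`. (177)
We would like to know that if `u′` is such a configuration and `u₁` belongs to a class `Λ_k(α₃)`, then the product `u′u₁` belongs to
some class `Λ_k(O(1)(α₃ + α₄))` also. Because we want some analyticity properties of `(1/i) log \overline{R₀u′u₁}ᵏ`, we will consider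
configurations `u′` with values in the complexified group `G^c`, i.e., `u′ = e^{iλ}` and `λ` has values in the complexified algebra
`g^c`. We will consider the averages `ũ′ʲ = \overline{R₀u′u₁}ʲ(\overline{R₀u₁}ʲ)⁻¹`. (178) As in the case of averages `Ũ′ʲ`, it can be
easily seen that they may be defined inductively as `ũ′¹ = ũ′ = \overline{R₀u′u₁}(\overline{R₀u₁})⁻¹,
ũ′^{j+1} = \overline{R̄₀ʲũ′ʲ\overline{R₀u₁}ʲ}(\overline{R̄₀ʲ\overline{R₀u₁}ʲ})⁻¹`. (179)"
p. 46: "We will prove that the configuration `ũ′ʲ` for `j ≦ k` satisfy the regularity conditions (176), (177) on proper scales and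
with different constants. As usual, we start with a careful analysis of a one-step operation. Let us assume that we have a gauge
field configuration `V₀` satisfying the regularity condition `|V₀(∂p) − 1| < α₀, p ⊂ Ω′`, and two gauge transformations `v′, v₁`
satisfying the conditions `|v′ − 1| < α₄, |v′⁻¹(b₋)R_{0,b}v′(b₊) − 1| < α′₄, |v₁ − 1| < α₃, |v₁⁻¹(y)(R₀v₁)(x) − 1| < Lα′₃`, (180)
`x ∈ B(y), y ∈ Ω′^{(1)}`. We assume that the constants are sufficiently small, so that we can apply proper theorems and estimates.
We will find a bound for `ṽ′⁻¹(c₋)R_{0,c}ṽ′(c₊) − 1`. We have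
`(\overline{R₀v′v₁})(y) = v′(y)v₁(y)·exp[iΣ_{x∈B(y)}L^{−d}(1/i) log(v′v₁)⁻¹(y)(R_{0,y}v′v₁)(x)]`, (181)
`(v′v₁)⁻¹(y)(R_{0,y}v′v₁)(x) = R(v₁⁻¹(y))[v′⁻¹(y)(R_{0,y}v′)(x)]·v₁⁻¹(y)(R_{0,y}v₁)(x)`, (182) and
`|v′⁻¹(y)(R_{0,y}v′)(x) − 1| < |Γ_{y,x}|α′₄e^{|Γ_{y,x}|α′₄} = O(Lα′₄)` by (180), hence
`(1/i) log(v′v₁)⁻¹(y)(R_{0,y}v′v₁)(x) = R(v₁⁻¹(y))(1/i) log v′⁻¹(y)·(R_{0,y}v′)(x) + (1/i) log v₁⁻¹(y)(R_{0,y}v₁)(x) + O(L²α′₃α′₄)`.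
(183) A constant in the bound above is an absolute constant. Using (41) and (181), (183) we get
`ṽ′(y) = v′(y)v₁(y) exp[iΣ_{x∈B(y)}L^{−d}R(v₁⁻¹(y))(1/i) log v′⁻¹(y)·(R_{0,y}v′)(x) + O(L²α′₃α′₄) + (L²α′₄²)]v₁⁻¹(y)
= v′(y) exp[iΣ_{x∈B(y)}L^{−d}(1/i) log v′⁻¹(y)(R_{0,y}v′)(x) + O(L²(α′₃ + α′₄)α′₄)]`. (184) Let us denote
`V′_b = v′⁻¹(b₋)R_{0,b}v′(b₊)`, then `|V′_b − 1| < α′₄e^{α′₄}, V′_b = e^{iA_b}, |A_b| < 2α′₄`. (185) Using this we can write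
`v′⁻¹(y)(R_{0,y}v′)(x) = ∏_{b⊂Γ_{y,x}} R(V₀(Γ_{y,b₋}))V′_b = (R_{0,y}V′)(Γ_{y,x})`, (186)"  p. 47: "and we have
`(1/i) log(R_{0,y}V′)(Γ_{y,x}) = (R_{0,y}A)(Γ_{y,x}) + O((Lα′₄)²)`. (187) Now using this and the representation (184), we have"
(188) [the product of the two block exponentials around `v′⁻¹(c₋)R̄_{0,c}v′(c₊)`], then (189), and "We will transform the linear
terms in `A` on the right-hand side of (189). Let us notice that by the definition (185) of `A` and by the identity `log v⁻¹ = −log v`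
we have … hence `−A_b = R_{0,b}A_{−b}`. (190)"  p. 48: (191), "similarly for the third term on the right-hand side of (189). Taking
this into account, we have `ṽ′⁻¹(c₋)R̄_{0,c}ṽ′(c₊) − 1 = iΣ_{x∈B(c₋)}L^{−d}(R_{0,c₋}A)([x,x′]) − iΣ_{x∈B(c₋)}L^{−d}(R_{0,c₋}A)(Γ_{c,x} ∪ (−c))
+ O(L²(α₀α₄ + α₀α′₄ + α′₃α′₄ + α′₄²))`. (192) Let us now estimate the terms `(R_{0,c₋}A)(Γ_{c,x} ∪ (−c))`. They almost vanish
because by the definition (185) `A` is almost equal to the derivative of `λ = (1/i) log v′`. We will prove in fact that they are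
small. Similarly, as in (187) we have `(R_{0,c₋}A)(Γ_{c,x} ∪ (−c)) = (1/i) log(R_{0,c₋}V′)(Γ_{c,x} ∪ (−c)) + O((Lα′₄)²)`, (193) and
`(R_{0,c₋}V′)(Γ_{c,x} ∪ (−c)) = v′⁻¹(c₋)R(V₀(Γ_{c,x} ∪ (−c)))v′(c₋) = 1 + v′⁻¹(c₋)[R(V₀(Γ_{c,x} ∪ (−c))) − 1](v′(c₋) − 1)
= 1 + O(L²α₀α₄)`, (194) hence `(R_{0,c₋}A)(Γ_{c,x} ∪ (−c)) = O(L²(α₀α₄ + α′₄²))`. (195) This gives us finally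
`ṽ′⁻¹(c₋)R̄_{0,c}ṽ′(c₊) − 1 = iΣ_{x∈B(c)}L^{−d}(R_{0,c₋}A)([x,x′]) + O(L²(α₀α₄ + α₀α′₄ + α′₃α′₄ + α′₄²))`. (196) From this we
easily get a bound if we notice that `A_b = (1/i)(v′⁻¹(b₋)R_{0,b}v′(b₊) − 1) + O(α′₄²)`. This implies `|A_b| < α′₄ + O(α′₄²)`, and
`|ṽ′⁻¹(c₋)R̄_{0,c}ṽ′(c₊) − 1| < Lα′₄ + O(L²(α₀α₄ + α₀α′₄ + α′₃α′₄ + α′₄²))`. (197)"  p. 49: "From representation (184) we obtain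
also `|ṽ′(y) − 1| < α₄ + O(Lα′₄) + O(L²(α′₃ + α′₄)α′₄) ≦ α₄ + O(Lα′₄)`. (198) Let us formulate these results in **Proposition 9.**
There exist positive constants `C′₄, C′₅, c′₆` such that for arbitrary functions `V₀, v′, v₁` satisfying (180) with
`α₀, α₃, α′₃, α₄, α′₄ ≦ c′₆`, the following bounds hold: `|ṽ′⁻¹(c₋)R̄_{0,c}ṽ′(c₊) − 1| < Lα′₄ + C′₄L²(α₀α₄ + α′₃α′₄ + α′₄²)`, (199)
`|ṽ′(y) − 1| < α₄ + C′₅Lα′₄`. (200)  In these bounds we have assumed that `α′₄ = O(α₄)`, which will always be true here and in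
forthcoming papers."  (After (179) print passes directly to the one-step operation `ṽ′ = \overline{R₀v′v₁}(\overline{R₀v₁})⁻¹` of
(180)–(184); the phrase "it is sufficient to analyze one such averaging operation" in v1 was the typing seat's gloss, not print.)

WHAT IS TYPED. The FLAT-BACKGROUND case `V₀ = 1` (so `α₀ = 0`, all rotations `R₀, R̄₀, R_{0,b}, R(V₀(Γ))` are the identity)
of (176)–(200) and of Proposition 9, as KERNEL THEOREMS with EXPLICIT CONSTANTS over the concrete model of this package (`𝔸` a
complete normed `ℂ`-algebra, gauge transformations `v : ℤ^d → 𝔸ˣ`, the site average (78) `B7Eq99Concrete.savg`/`Sexp`, the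
`j`-fold average (80) `B7Eq84Concrete.uavg L 1`):
* §1 `norm_mlog_exp_add_mul_exp_neg_sub_le`, `exp_add_eq_exp_mul_exp` — **(41) in bilinear form**:
  `‖log(e^{X+Y}e^{−Y}) − X‖ ≤ 3‖X‖‖Y‖` for `‖X‖ ≤ 1/10`, `‖Y‖ ≤ 1/25` (Schwarz lemma `B11SchwarzRemainder.norm_le_of_orderGe` on
  the holomorphic function (39) `B7Eq38Remainder.Z39` minus its linear germ, bounded by (31) `B7Eq170Flat.norm_bchRem_le`);
  `exp_mul3_eq` — three exponentials merged by (31).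
* §2 `SiteBd`/`BondBd`/`BlockBd` — the conditions (176)/(177)/(180) at `V₀ = 1`; `Vb`, `Ab`, `hol_Vb`, `Vb_exp_data` — **(185)–(186)**
  (`V′_b = v′(b₋)⁻¹v′(b₊)` is the pure gauge `1^{v′⁻¹}`, its holonomy telescopes, `V′_b = e^{A_b}`, `‖A_b‖ ≤ α′₄ + 4α′₄²`);
  `walk_log` — **(182)/(187)** along a word (`‖log V′(Γ) − A(Γ)‖ ≤ 17θ²` for `|Γ|·‖A‖ ≤ θ ≤ 1/64`); `norm_asum_loop_le` —
  **(193)–(195)** (a closed word has holonomy EXACTLY `1` at `V₀ = 1`, so `‖A(loop)‖ ≤ θ²`); `asum_loop` — the algebra of (190)–(192).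
* §3 `eq182`, `rem183`, `norm_rem183_le`, `Sexp_mul`, **`eq184`** — **(181)–(184)** with the bilinear remainder:
  `ṽ′(y) = v′(y)·exp[S_{v′}(y) + Φ]`, `‖Φ‖ ≤ 92pq` for `‖v′(y)⁻¹v′(x) − 1‖ ≤ p ≤ 1/50`, `‖v₁(y)⁻¹v₁(x) − 1‖ ≤ q ≤ 1/50` on the block.
* §4 `vtil` (= (179) one step) and `util`/`util_zero`/`util_succ` (= **(178)/(179)**, `ũ′^{j+1} = (ũ′ʲ·ū₁ʲ)‾·(ū₁^{j+1})⁻¹`);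
  `block_walk`, `seg_walk`, `loop_walk`; **`core200`** (`‖ṽ′ − 1‖ ≤ α₄ + 16θ + 736θq`) and **`core199`**
  (`‖ṽ′(y)⁻¹ṽ′(y′) − 1‖ ≤ La + 2300θ² + 368θq`, `θ = (d+1)La`, `a = α′₄ + 4α′₄²`).
* §5 **`prop9_flat`** — Proposition 9 at `V₀ = 1`: under (180) (`SiteBd v′ α₄`, `BondBd v′ α′₄`, `SiteBd v₁ α₃`,
  `BlockBd L v₁ (Lα′₃)`) and the explicit smallness `α₄ ≤ 1`, `α₃ ≤ 1/5`, `50Lα′₃ ≤ 1`, `10³(d+1)Lα′₄ ≤ 1`: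
  (199) `BondBd ṽ′ (Lα′₄ + C′₄L²(α′₃α′₄ + α′₄²))` and (200) `SiteBd ṽ′ (α₄ + C′₅Lα′₄)` with `C′₄ = 10⁴(d+1)²`, `C′₅ = 64(d+1)`
  (`arith199`, `arith200`, `setup` are the arithmetic).  The conclusions are literally the hypotheses (180a)/(180b) one scale up
  (coarse coordinates), i.e. the input of the induction (201)–(206) of Proposition 10.

READINGS (recorded in `DIVERGENCE.md` D-b07g22.1; none is an objection to print).
(a) FLAT BACKGROUND ONLY: print's one-step analysis is written for a background `V₀` with `|V₀(∂p) − 1| < α₀`; here `V₀ = 1`: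
    the `α₀`-terms of (188), (191)–(197), (199) are absent, (194) is the exact identity `V′(loop) = 1`, and the remark
    "`α′₄ = O(α₄)`" (which absorbs the `α₀α′₄`-term of (197) into (199)) is moot.  The curved case needs Props. 3–6 at a general
    `U₀`, which this package has at `U₀ = 1` only (`B7Prop6Flat`); its hand certification is `GAPS.md` C-adv4-25 / C-B7-F, the
    schematic printed statements are `B7.Prop9Printed`-level names in `B7.lean` (by name; different interface, not instantiated).
(b) BANACH READING of `|·|`: print's `v′, v₁, V′_b` are (near-)unitary matrices and `R(·)` is an isometry; here conjugation by
    `v₁(y)^{±1}` with `‖v₁(y)^{±1} − 1‖ ≤ 2/5` costs a factor `2` (`B7Eq170Flat.norm_cj_le_two_mul`), `‖log W‖ ≤ 2‖W − 1‖`,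
    `|e^M − 1| ≤ e^{‖M‖} − 1`; all constants are explicit and absolute except for the announced `d`-dependence.
(c) THE BILINEAR (41): print's "(41) … `+ O(|X|²)`" is used here in the sharper, manifestly bilinear form `log(e^{X+Y}e^{−Y}) = X +
    O(|X||Y|)` (the function vanishes identically at `Y = 0`), so the remainder `Φ` of (184) is `O(pq) = O(dL²α′₃α′₄)` with NO
    `α′₄²`- and NO `α′₃²`-term; the `α′₄²`-terms of (199) come from (187), (193)–(195) and the merging (31) only (cf. the reader
    note of C-adv4-25 on the origin of print's `α′₄²` in (184)).  This is what makes `ṽ′ ≡ 1` for `v′ ≡ 1` visible in the bounds and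
    feeds `β = α₀α₄ + α₃α₄ + α₄²` of Proposition 10 without an `α₃²`-term.
(d) LEADING COEFFICIENT ONE: the main term of (192)/(196) is `Σ_{x∈B(c₋)}L^{−d}A([x,x′])`, `L` bonds each, so `≤ L·sup‖A_b‖ ≤
    L(α′₄ + 4α′₄²)`; print's refinement "`|A_b| < α′₄ + O(α′₄²)`" (p. 48) is `Vb_exp_data`; the `4Lα′₄²` is put into `C′₄L²α′₄²`.
(e) EXPLICIT SMALLNESS: print's "`α₀, α₃, α′₃, α₄, α′₄ ≦ c′₆`" becomes `α₄ ≤ 1`, `α₃ ≤ 1/5`, `50Lα′₃ ≤ 1`, `10³(d+1)Lα′₄ ≤ 1`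
    (`c′₆` depending on `d` and `L`, as p. 49 l. 1–2 "≦ α₄ + O(Lα′₄)" already requires `L(α′₃ + α′₄) = O(1)`); `0 ≤ α′₄` is
    assumed (vacuous bonds in `d = 0`).
(f) LATTICE: all of `ℤ^d` for `Ω`, blocks `B(y) = y + [0,L)^d` with corner `y = Lz` and the tree contours `Γ_{y,x}` of (77)
    (`B7Prop1Explicit.treeWord`), the coarse bond `c = ⟨Lz, L(z + e_μ)⟩` = the straight word of `L` bonds (`seg μ L`); `ṽ′` is
    indexed by the block label `z ∈ ℤ^d` (`vtil L v′ v₁ z`, as (80) `uavg`), so (199)/(200) are `BondBd`/`SiteBd` of `vtil`.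
(g) `≤` for `<` throughout, as in the whole package.
Print-level slips in this passage recorded earlier (not re-filed): (188) LHS `R_{0,c}` for `R̄_{0,c}`, (196) "`x ∈ B(c)`" for
`B(c₋)`, the dropped power of `L` in the `α₀`-terms p. 47 (N-B7-F1) — all outside the flat case or cosmetic.

DECLARATIONS (10 definitions `SiteBd BondBd BlockBd Vb Ab rem183 vtil util C5' C4'`; 33 theorems; imports `B7Prop8Flat`,
`B7Eq38Remainder` only).  Reused BY NAME (not restated): `B7Eq38Remainder.Z39`, `Z39_zero`, `differentiableOn_Z39`,
`norm_exp_mul_exp_sub_one_le`; `B11SchwarzRemainder.OrderGe`, `norm_le_of_orderGe`; `B7Eq170Flat.bchRem`, `norm_bchRem_le`,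
`exp_mul_exp_eq`, `exp_mul4_eq`, `mlog_exp_of_le`, `cj`, `exp_cj`, `norm_cj_le_two_mul`, `bmean`, `Sexp_eq_bmean`,
`norm_bmean_le`; `B7Eq99Concrete.Sexp`, `savg`; `B7Eq84Concrete.uavg`, `uavg_succ_one_left`; `B7Eq92Concrete.Rc`, `expUnit_conj`;
`B7Eq167Flat.exp_sub_one_le_two_mul_of_le`; `B7Prop1Explicit.hol`, `gaugeAct`, `hol_gaugeAct`, `asum`, `asum_append`,
`asum_revWord'`, `walk_linear`, `norm_asum_le`, `norm_mlog_sub_le`, `treeWord`, `seg`, `boxVec`, `expRem`, `expUnit`;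
`B8Ineq130.hol_one`; `B7Prop6Flat.norm_units_inv_sub_one_le`; `B7Prop6Bound.mul_sub_one_norm_le`; `B7Transfer.norm_exp_sub_one_le_of_le`;
`MatrixLog.mlog`, `exp_mlog`, `norm_mlog_le_two_mul`.

VERSION. v1.0.1 = v1 (p194000) with the PRINT paragraph above and seven declaration docstrings (`Vb_exp_data`, `vtil`, `util`,
`util_succ`, `seg_walk`, `loop_walk`, `asum_loop`: quotations and page numbers of (185)/(186)) re-quoted VERBATIM from the renders
p029–p033; v1 had carried paraphrases of p. 45 and of (180)/(185)/(188)/(195) from the lineage transcript.  No declaration, statement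
or proof changed.

[cite: Balaban1985Averaging, Proposition 9 p.49, (176)–(179) p.45, (180)–(186) p.46, (187)–(189) p.47, (190)–(196) p.48,
(197)–(200) p.49, (31) p.22, (39)/(41) p.23, (78)–(80) p.30]
-/

noncomputable section

open NormedSpace Finset Metric

namespace Literature.MathematicalPhysics.QuantumFieldTheory.Balaban1983to89.B7Prop9Flat

open B7Prop1Explicit MatrixLog B7Eq92Concrete B7Eq99Concrete B7Eq84Concrete B7Eq167Flat B7Eq170Flat B7Prop8Flat
open B7Eq38Remainder (Z39 Z39_zero differentiableOn_Z39 norm_exp_mul_exp_sub_one_le)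
open B11SchwarzRemainder (OrderGe norm_le_of_orderGe)
open B8Ineq130 (hol_one)
open B7Prop6Flat (norm_units_inv_sub_one_le)

export B7Prop1Explicit (Site)

variable {d : ℕ}

/-! ## §1 Two merging tools: the bilinear form of (41), and three exponentials -/

section Merge

variable {𝔸 : Type*} [NormedRing 𝔸] [NormedAlgebra ℂ 𝔸] [CompleteSpace 𝔸]

omit [CompleteSpace 𝔸] in
/-- The function (39) minus its linear germ is the BCH remainder (31) of the pair `(uX + Y, −Y)`:
`log e^{uX+Y}e^{−Y} − uX = σ(uX + Y, −Y)` (an algebraic identity). [cite: Balaban1985Averaging, (39) p.23, (31) p.22] -/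
theorem Z39_sub_smul (X Y : 𝔸) (u : ℂ) : Z39 X Y u - u • X = bchRem (u • X + Y) (-Y) := by
  rw [bchRem_def]
  simp only [Z39]
  abel

/-- **(41) in bilinear form.**  Print (41): "`(1/i) log e^{iX+iY}e^{−iY} = g(−i ad_Y)X + O(|X|²)`", with `g(−i ad_Y)X = X + O(|X||Y|)`
((33): `g(z) = 1 − z/2 + …`).  Kernel form used below: for `‖X‖ ≤ 1/10`, `‖Y‖ ≤ 1/25`,
`‖log (e^{X+Y}e^{−Y}) − X‖ ≤ 3‖X‖‖Y‖` — the remainder vanishes at `Y = 0` AND is `O(|X|)`; no pure `|Y|²` or `|X|²` term is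
claimed or needed.  Proof: `u ↦ log e^{uX+Y}e^{−Y} − uX` is holomorphic on the disc `|u|·‖X‖ < 1/9` (`B7Eq38Remainder.differentiableOn_Z39`),
vanishes at `0`, and is bounded there by `2(1/9 + ‖Y‖)‖Y‖` ((31), `B7Eq170Flat.norm_bchRem_le`); the Schwarz lemma
(`B11SchwarzRemainder.norm_le_of_orderGe`, `n = 1`) gives the value at `u = 1`. [cite: Balaban1985Averaging, (41) p.23, (31) p.22, (33) p.22] -/
theorem norm_mlog_exp_add_mul_exp_neg_sub_le {X Y : 𝔸} (hX : ‖X‖ ≤ 1 / 10) (hY : ‖Y‖ ≤ 1 / 25) :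
    ‖mlog (exp (X + Y) * exp (-Y)) - X‖ ≤ 3 * ‖X‖ * ‖Y‖ := by
  by_cases hX0 : X = 0
  · subst hX0
    simp [Literature.Analysis.Calculus.exp_mul_exp_neg, mlog_one]
  have hXpos : 0 < ‖X‖ := norm_pos_iff.mpr hX0
  have hY0 := norm_nonneg Y
  set ρ : ℝ := (9 * ‖X‖)⁻¹ with hρdef
  have h9 : 0 < 9 * ‖X‖ := by positivity
  have hρpos : 0 < ρ := inv_pos.mpr h9
  have hρX : ρ * ‖X‖ = 1 / 9 := by rw [hρdef]; field_simp
  have hY12 : ‖Y‖ ≤ 1 / 12 := hY.trans (by norm_num)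
  -- the function `g(u) = Z39(u) − uX`
  set g : ℂ → 𝔸 := fun u => Z39 X Y u - u • X with hg
  have hgd : DifferentiableOn ℂ g (ball 0 ρ) :=
    (differentiableOn_Z39 X hY12 (by rw [hρX]; norm_num)).sub (differentiableOn_id.smul_const X)
  have hg0 : g 0 = 0 := by simp [hg, Z39_zero]
  -- its bound on the disc, by (31)
  set M : ℝ := 2 * (1 / 9 + ‖Y‖) * ‖Y‖ with hMdef
  have hM : ∀ t ∈ ball (0 : ℂ) ρ, ‖g t‖ ≤ M := by
    intro t ht
    have htX : ‖t • X‖ ≤ 1 / 9 := by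
      rw [norm_smul]
      have ht' : ‖t‖ < ρ := mem_ball_zero_iff.mp ht
      calc ‖t‖ * ‖X‖ ≤ ρ * ‖X‖ := by gcongr
        _ = 1 / 9 := hρX
    have h1 : ‖t • X + Y‖ + ‖-Y‖ ≤ 1 / 5 := by
      rw [norm_neg]; linarith [norm_add_le (t • X) Y]
    have h2 := norm_bchRem_le h1
    have h3 : ‖t • X + Y‖ ≤ 1 / 9 + ‖Y‖ := (norm_add_le _ _).trans (by linarith)
    show ‖Z39 X Y t - t • X‖ ≤ M
    rw [Z39_sub_smul]
    refine h2.trans ?_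
    rw [norm_neg, hMdef]
    gcongr
  -- order ≥ 1 at 0
  have hgO : OrderGe g 1 := by
    have hda : DifferentiableAt ℂ g 0 := hgd.differentiableAt (ball_mem_nhds _ hρpos)
    have hcont : ContinuousAt (dslope g 0) 0 := continuousAt_dslope_same.mpr hda
    refine OrderGe.of_eq_pow_smul hcont fun s => ?_
    have h := sub_smul_dslope g 0 s
    rw [sub_zero, hg0, sub_zero] at h
    rw [pow_one, h]
  -- Schwarz at `u = 1`
  have h1 : (1 : ℂ) ∈ ball (0 : ℂ) ρ := by
    rw [mem_ball_zero_iff, norm_one, hρdef]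
    rw [one_lt_inv_iff₀]
    exact ⟨h9, by linarith⟩
  have h := norm_le_of_orderGe hgd hM hgO h1
  have hval : g 1 = mlog (exp (X + Y) * exp (-Y)) - X := by simp [hg, Z39, one_smul]
  rw [hval, pow_one, norm_one, hρdef, div_inv_eq_mul, one_mul, hMdef] at h
  refine h.trans ?_
  have hxy : 0 ≤ ‖X‖ * ‖Y‖ := mul_nonneg hXpos.le hY0
  have h18 : 18 * ‖Y‖ ≤ 1 := by linarith
  nlinarith [mul_le_mul_of_nonneg_left h18 hxy]

/-- **(41), bilinear form, as a factorisation**: for `‖X‖ ≤ 1/10`, `‖Y‖ ≤ 1/25` there is `Ψ` with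
`e^{X+Y} = e^{X+Ψ}e^{Y}` and `‖Ψ‖ ≤ 3‖X‖‖Y‖` (`Ψ = log(e^{X+Y}e^{−Y}) − X`; `exp ∘ log = id` on the disc of (21)).
[cite: Balaban1985Averaging, (41) p.23, (21) p.21] -/
theorem exp_add_eq_exp_mul_exp {X Y : 𝔸} (hX : ‖X‖ ≤ 1 / 10) (hY : ‖Y‖ ≤ 1 / 25) :
    ∃ Ψ : 𝔸, exp (X + Y) = exp (X + Ψ) * exp Y ∧ ‖Ψ‖ ≤ 3 * ‖X‖ * ‖Y‖ := by
  refine ⟨mlog (exp (X + Y) * exp (-Y)) - X, ?_, norm_mlog_exp_add_mul_exp_neg_sub_le hX hY⟩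
  have h1 : ‖exp (X + Y) * exp (-Y) - 1‖ < 1 := by
    refine lt_of_le_of_lt (norm_exp_mul_exp_sub_one_le (X + Y) (-Y)) ?_
    have h2 : ‖X + Y‖ + ‖-Y‖ ≤ 1 / 5 := by rw [norm_neg]; linarith [norm_add_le X Y]
    have := Real.exp_le_exp.mpr h2
    linarith [exp_one_fifth_sub_one_lt_one]
  have h2 : exp (-Y) * exp Y = (1 : 𝔸) := by simpa using Literature.Analysis.Calculus.exp_mul_exp_neg (-Y)
  rw [add_sub_cancel, exp_mlog h1, mul_assoc, h2, mul_one]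

/-- **Merging three exponentials** (three factors of (31)): `‖B₁‖ + ‖B₂‖ + ‖B₃‖ ≤ s ≤ 1/20 ⟹ e^{B₁}e^{B₂}e^{B₃} = e^{B₁+B₂+B₃+ρ}`,
`‖ρ‖ ≤ 5s²` (`B7Eq170Flat.exp_mul4_eq` with `B₄ = 0`). [cite: Balaban1985Averaging, (31) p.22] -/
theorem exp_mul3_eq {B₁ B₂ B₃ : 𝔸} {s : ℝ} (hB : ‖B₁‖ + ‖B₂‖ + ‖B₃‖ ≤ s) (hs : s ≤ 1 / 20) :
    ∃ ρ : 𝔸, exp B₁ * exp B₂ * exp B₃ = exp (B₁ + B₂ + B₃ + ρ) ∧ ‖ρ‖ ≤ 5 * s ^ 2 := by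
  have hB' : ‖B₁‖ + ‖B₂‖ + ‖B₃‖ + ‖(0 : 𝔸)‖ ≤ s := by rw [norm_zero, add_zero]; exact hB
  obtain ⟨ρ, hρ, hρn⟩ := exp_mul4_eq hB' hs
  refine ⟨ρ, ?_, hρn⟩
  rw [exp_zero, mul_one, add_zero] at hρ
  exact hρ

end Merge

/-! ## §2 The conditions (176)/(177)/(180) and the bond field (185)–(187) at the flat background `V₀ = 1` -/

section Bond

variable {𝔸 : Type*} [NormedRing 𝔸] [NormedAlgebra ℂ 𝔸] [CompleteSpace 𝔸]

/-- **(176) / (180a) / (180c)** at `V₀ = 1`: "`|u′(x) − 1| < α₄, x ∈ Ω`" — a site function within `α` of `1` (all sites of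
`ℤ^d`; `≤` for `<`). [cite: Balaban1985Averaging, (176) p.45, (180) p.46] -/
def SiteBd (v : Site d → 𝔸ˣ) (α : ℝ) : Prop := ∀ x : Site d, ‖((v x : 𝔸ˣ) : 𝔸) - 1‖ ≤ α

/-- **(177) / (180b)** at `V₀ = 1`: "`|u′⁻¹(b₋)R_{0,b}u′(b₊) − 1| < α₄η, b ⊂ Ω`" — with `R_{0,b} = R(V_{0,b}) = id` at `V₀ = 1`,
for the bond `b = ⟨x, x + e_κ⟩`: `‖u′(x)⁻¹u′(x + e_κ) − 1‖ ≤ α` (all bonds of `ℤ^d`; `α` stands for `α₄η` resp. `α′₄`; `≤` for `<`).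
[cite: Balaban1985Averaging, (177) p.45, (180) p.46, (56) p.27] -/
def BondBd (v : Site d → 𝔸ˣ) (α : ℝ) : Prop :=
  ∀ (x : Site d) (κ : Fin d), ‖((((v x)⁻¹ * v (x + e κ) : 𝔸ˣ)) : 𝔸) - 1‖ ≤ α

/-- **(180d)** at `V₀ = 1`: "`|v₁⁻¹(y)(R₀v₁)(x) − 1| < Lα′₃, x ∈ B(y), y ∈ Ω′^{(1)}`" — the block corners `y = Lz`, the block
points `x = Lz + r`, `r ∈ [0, L)^d` (`boxVec`), `(R₀v₁)(x) = v₁(x)` at `V₀ = 1`; `β` stands for `Lα′₃` (the shape of (167),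
`B7Prop8Flat.cond167_one_left_iff`). [cite: Balaban1985Averaging, (180) p.46, (167) p.44] -/
def BlockBd (L : ℕ) (v : Site d → 𝔸ˣ) (β : ℝ) : Prop :=
  ∀ (z : Site d) (r : Fin d → Fin L), ‖((((v ((L : ℤ) • z))⁻¹ * v ((L : ℤ) • z + boxVec L r) : 𝔸ˣ)) : 𝔸) - 1‖ ≤ β

/-- **(185)**, the bond variables of `v′` at `V₀ = 1`: "`V′_b = v′⁻¹(b₋)R_{0,b}v′(b₊)`", `b = ⟨x, x + e_κ⟩`, `R_{0,b} = id`.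
[cite: Balaban1985Averaging, (185) p.46] -/
def Vb (v : Site d → 𝔸ˣ) : Site d → Fin d → 𝔸ˣ := fun x κ => (v x)⁻¹ * v (x + e κ)

omit [NormedAlgebra ℂ 𝔸] [CompleteSpace 𝔸] in
/-- `Vb_apply`: unfolding. [cite: Balaban1985Averaging, (185) p.46] -/
@[simp] theorem Vb_apply (v : Site d → 𝔸ˣ) (x : Site d) (κ : Fin d) : Vb v x κ = (v x)⁻¹ * v (x + e κ) := rfl

omit [NormedAlgebra ℂ 𝔸] [CompleteSpace 𝔸] in
/-- The bond field `V′` is the pure gauge (8) of the constant configuration `1` by `v′⁻¹`: `V′ = 1^{v′⁻¹}`.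
[cite: Balaban1985Averaging, (185) p.46, (8) p.18] -/
theorem Vb_eq_gaugeAct (v : Site d → 𝔸ˣ) : Vb v = gaugeAct v⁻¹ (1 : Site d → Fin d → 𝔸ˣ) := by
  funext x κ
  simp [gaugeAct]

omit [NormedAlgebra ℂ 𝔸] [CompleteSpace 𝔸] in
/-- **(186)** at `V₀ = 1`: "`v′⁻¹(y)(R_{0,y}v′)(x) = ∏_{b⊂Γ_{y,x}} R(V₀(Γ_{y,b₋}))V′_b = (R_{0,y}V′)(Γ_{y,x})`" — with `V₀ = 1` all
rotations are the identity and the product telescopes: for EVERY lattice word `Γ` from `y`, `V′(Γ) = v′(y)⁻¹v′(y + disp Γ)`.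
[cite: Balaban1985Averaging, (186) p.46, (9) p.18] -/
theorem hol_Vb (v : Site d → 𝔸ˣ) (x : Site d) (w : List (Letter d)) :
    hol (Vb v) x w = (v x)⁻¹ * v (x + disp w) := by
  rw [Vb_eq_gaugeAct, hol_gaugeAct, hol_one]
  simp

omit [NormedAlgebra ℂ 𝔸] [CompleteSpace 𝔸] in
/-- The bond condition (177)/(180b) is a bound on the bond field (185). [cite: Balaban1985Averaging, (185) p.46, (180) p.46] -/
theorem bondBd_iff (v : Site d → 𝔸ˣ) (α : ℝ) : BondBd v α ↔ ∀ x κ, ‖((Vb v x κ : 𝔸ˣ) : 𝔸) - 1‖ ≤ α := Iff.rfl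

/-- **(185)**, the bond potentials: "`V′_b = e^{iA_b}`", `A_b := log V′_b` (the series (21); print's `i` absorbed).
[cite: Balaban1985Averaging, (185) p.46, (21) p.21] -/
def Ab (v : Site d → 𝔸ˣ) : Site d → Fin d → 𝔸 := fun x κ => mlog ((Vb v x κ : 𝔸ˣ) : 𝔸)

/-- **(185)**: "then `|V′_b − 1| < α′₄e^{α′₄}, V′_b = e^{iA_b}, |A_b| < 2α′₄`" — kernel form: under (180b) with
`α′₄ ≤ ½`, `V′_b = exp A_b` (`exp ∘ log = id` on the disc of (21)) and `‖A_b‖ ≤ α′₄ + 4α′₄²` (`≤ 2α′₄`; from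
`‖log W − (W − 1)‖ ≤ ρ(2|W − 1|) ≤ 4|W − 1|²`, `B7Prop1Explicit.norm_mlog_sub_le`).  (Print's first bound carries the factor
`e^{α′₄}` of the rotation `R_{0,b}`, absent at `V₀ = 1`.) [cite: Balaban1985Averaging, (185) p.46, (26)–(27) p.21] -/
theorem Vb_exp_data {v : Site d → 𝔸ˣ} {α : ℝ} (hα : α ≤ 1 / 2) (hv : BondBd v α) (x : Site d) (κ : Fin d) :
    ((Vb v x κ : 𝔸ˣ) : 𝔸) = exp (Ab v x κ) ∧ ‖Ab v x κ‖ ≤ α + 4 * α ^ 2 := by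
  have h := hv x κ
  rw [← Vb_apply] at h
  have hα0 : 0 ≤ α := (norm_nonneg _).trans h
  have hlt : ‖((Vb v x κ : 𝔸ˣ) : 𝔸) - 1‖ < 1 := lt_of_le_of_lt h (by linarith)
  refine ⟨(exp_mlog hlt).symm, ?_⟩
  have h2 := B7Prop1Explicit.norm_mlog_sub_le (h.trans hα)
  have h3 : expRem (2 * ‖((Vb v x κ : 𝔸ˣ) : 𝔸) - 1‖) ≤ (2 * α) ^ 2 :=
    (expRem_mono (by positivity) (by linarith)).trans (expRem_le_sq (by positivity) (by linarith))
  calc ‖Ab v x κ‖ = ‖(mlog ((Vb v x κ : 𝔸ˣ) : 𝔸) - (((Vb v x κ : 𝔸ˣ) : 𝔸) - 1)) + (((Vb v x κ : 𝔸ˣ) : 𝔸) - 1)‖ := by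
        rw [Ab, sub_add_cancel]
    _ ≤ ‖mlog ((Vb v x κ : 𝔸ˣ) : 𝔸) - (((Vb v x κ : 𝔸ˣ) : 𝔸) - 1)‖ + ‖((Vb v x κ : 𝔸ˣ) : 𝔸) - 1‖ := norm_add_le _ _
    _ ≤ (2 * α) ^ 2 + α := add_le_add (h2.trans h3) h
    _ = α + 4 * α ^ 2 := by ring

/-- **(186)–(187) along one word, kernel form at `V₀ = 1`** (print (187): "`(1/i) log (R_{0,y}V′)(Γ_{y,x}) = (R_{0,y}A)(Γ_{y,x})
+ O((Lα′₄)²)`", and the bound "`|v′⁻¹(y)(R_{0,y}v′)(x) − 1| < |Γ_{y,x}|α′₄e^{|Γ_{y,x}|α′₄} = O(Lα′₄)`" of (182)): if `V′_b = e^{A_b}`,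
`‖A_b‖ ≤ a` on all bonds and `|Γ|·a ≤ θ ≤ 1/64`, then for the word `Γ` from `x`:
`‖v′(x)⁻¹v′(x + disp Γ) − 1‖ ≤ 2θ`, `‖log(…)‖ ≤ 4θ`, `‖log(v′(x)⁻¹v′(x + disp Γ)) − A(Γ)‖ ≤ 17θ²`, `‖A(Γ)‖ ≤ θ`
(`B7Prop1Explicit.walk_linear`, `norm_mlog_sub_le`, `norm_asum_le`). [cite: Balaban1985Averaging, (186) p.46, (187) p.47, (182) p.46] -/
theorem walk_log {v : Site d → 𝔸ˣ} {a θ : ℝ} (ha : 0 ≤ a)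
    (hVA : ∀ (x : Site d) (κ : Fin d), ((Vb v x κ : 𝔸ˣ) : 𝔸) = exp (Ab v x κ) ∧ ‖Ab v x κ‖ ≤ a)
    (hθ0 : 0 ≤ θ) (hθ1 : θ ≤ 1 / 64) (x : Site d) (w : List (Letter d)) (hw : (w.length : ℝ) * a ≤ θ) :
    ‖((((v x)⁻¹ * v (x + disp w) : 𝔸ˣ)) : 𝔸) - 1‖ ≤ 2 * θ ∧
      ‖mlog ((((v x)⁻¹ * v (x + disp w) : 𝔸ˣ)) : 𝔸)‖ ≤ 4 * θ ∧
      ‖mlog ((((v x)⁻¹ * v (x + disp w) : 𝔸ˣ)) : 𝔸) - asum (Ab v) x w‖ ≤ 17 * θ ^ 2 ∧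
      ‖asum (Ab v) x w‖ ≤ θ := by
  set R : ℕ := l1 (x - x) + w.length with hR
  obtain ⟨h1, h2⟩ := walk_linear (Vb v) (Ab v) x R ha (fun x' κ _ => hVA x' κ) w x le_rfl
  rw [hol_Vb] at h1 h2
  have hW : ‖((((v x)⁻¹ * v (x + disp w) : 𝔸ˣ)) : 𝔸) - 1‖ ≤ 2 * θ := h1.trans (exp_sub_one_le_of_le hw hθ0 hθ1)
  have hW' : ‖((((v x)⁻¹ * v (x + disp w) : 𝔸ˣ)) : 𝔸) - 1‖ ≤ 1 / 2 := hW.trans (by linarith)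
  have hlog : ‖mlog ((((v x)⁻¹ * v (x + disp w) : 𝔸ˣ)) : 𝔸)‖ ≤ 4 * θ := (norm_mlog_le_two_mul hW').trans (by linarith)
  have h3 := B7Prop1Explicit.norm_mlog_sub_le hW'
  have h4 : expRem (2 * ‖((((v x)⁻¹ * v (x + disp w) : 𝔸ˣ)) : 𝔸) - 1‖) ≤ 16 * θ ^ 2 :=
    (expRem_mono (by positivity) (by linarith)).trans (expRem4_le hθ0 hθ1)
  have h5 : expRem (w.length * a) ≤ θ ^ 2 := expRem_le_sq_of_le (by positivity) hw hθ0 hθ1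
  have hasum : ‖asum (Ab v) x w‖ ≤ θ :=
    (norm_asum_le (Ab v) x R ha (fun x' κ _ => (hVA x' κ).2) w x le_rfl).trans hw
  refine ⟨hW, hlog, ?_, hasum⟩
  have hid : mlog ((((v x)⁻¹ * v (x + disp w) : 𝔸ˣ)) : 𝔸) - asum (Ab v) x w =
      (mlog ((((v x)⁻¹ * v (x + disp w) : 𝔸ˣ)) : 𝔸) - (((((v x)⁻¹ * v (x + disp w) : 𝔸ˣ)) : 𝔸) - 1)) +
        (((((v x)⁻¹ * v (x + disp w) : 𝔸ˣ)) : 𝔸) - 1 - asum (Ab v) x w) := by abel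
  rw [hid]
  exact (norm_add_le _ _).trans (by linarith [h3.trans h4, h2.trans h5])

/-- **(193)–(195) at `V₀ = 1`: a closed contour is second order.**  Print bounds `(R_{0,c₋}A)(Γ_{c,x} ∪ (−c))` by writing it as
`(1/i) log` of the twisted holonomy `(R_{0,c₋}V′)(Γ_{c,x} ∪ (−c)) = R(…)v′⁻¹(c₋)R(V₀(∂□))v′(c₋)` (194), `= 1 + O(L²α₀α₄)` plus the
merging error `O((Lα′₄)²)`.  At `V₀ = 1` the holonomy of `V′` around ANY closed word is EXACTLY `1` ((186): it telescopes to
`v′(y)⁻¹v′(y) = 1`), so `A(Γ) = −(V′(Γ) − 1 − A(Γ))` is bounded by the second-order remainder alone: `‖A(Γ)‖ ≤ θ²` for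
`|Γ|·a ≤ θ ≤ 1/64`. [cite: Balaban1985Averaging, (193)–(195) p.48, (186) p.46] -/
theorem norm_asum_loop_le {v : Site d → 𝔸ˣ} {a θ : ℝ} (ha : 0 ≤ a)
    (hVA : ∀ (x : Site d) (κ : Fin d), ((Vb v x κ : 𝔸ˣ) : 𝔸) = exp (Ab v x κ) ∧ ‖Ab v x κ‖ ≤ a)
    (hθ0 : 0 ≤ θ) (hθ1 : θ ≤ 1 / 64) (x : Site d) (w : List (Letter d)) (hw : (w.length : ℝ) * a ≤ θ)
    (hdisp : disp w = 0) : ‖asum (Ab v) x w‖ ≤ θ ^ 2 := by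
  set R : ℕ := l1 (x - x) + w.length with hR
  obtain ⟨-, h2⟩ := walk_linear (Vb v) (Ab v) x R ha (fun x' κ _ => hVA x' κ) w x le_rfl
  rw [hol_Vb, hdisp, add_zero, inv_mul_cancel, Units.val_one, sub_self, zero_sub, norm_neg] at h2
  exact h2.trans (expRem_le_sq_of_le (by positivity) hw hθ0 hθ1)

omit [NormedAlgebra ℂ 𝔸] [CompleteSpace 𝔸] in
/-- **(190)–(192), the contour algebra**: for a word `Γ` (print: `Γ_{c₋,x}`) and a word `c` from `y` (print: the bond `c`, and
its translate `[x, x′]`), the closed word `Γ ∪ [x,x′] ∪ (−Γ′) ∪ (−c)` (`Γ′` = `Γ` translated by `disp c`, print's `Γ_{c₊,x′}`)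
has `A(loop) = A(Γ) + A([x,x′]) − A(Γ′) − A(c)` — print: "`−A_b = R_{0,b}A_{−b}`" (190) and "`… = iΣ_{x∈B(c₋)}L^{−d}(R_{0,c₋}A)([x,x′])
− iΣ_{x∈B(c₋)}L^{−d}(R_{0,c₋}A)(Γ_{c,x} ∪ (−c)) + O(…)`" (192) (`B7Prop1Explicit.asum_append`, `asum_revWord`).
[cite: Balaban1985Averaging, (190)–(192) p.48] -/
theorem asum_loop (A : Site d → Fin d → 𝔸) (y : Site d) (w c : List (Letter d)) :
    asum A y (w ++ c ++ revWord w ++ revWord c) =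
      asum A y w + asum A (y + disp w) c - asum A (y + disp c) w - asum A y c := by
  rw [asum_append, asum_append, asum_append,
    asum_revWord' A (x := y + disp c) (y + disp (w ++ c)) w (by rw [disp_append]; abel),
    asum_revWord' A (x := y) (y + disp (w ++ c ++ revWord w)) c (by rw [disp_append, disp_append, disp_revWord]; abel)]
  abel

end Bond

/-! ## §3 (181)–(184): one averaging step of the product `v′v₁` over a block, with a BILINEAR remainder -/

section Repr

variable {𝔸 : Type*} [NormedRing 𝔸] [NormedAlgebra ℂ 𝔸] [CompleteSpace 𝔸]
variable (L : ℕ) (v' v₁ : Site d → 𝔸ˣ) (y : Site d)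

omit [NormedAlgebra ℂ 𝔸] [CompleteSpace 𝔸] in
/-- **(182)** at `V₀ = 1`: "`(v′v₁)⁻¹(y)(R_{0,y}v′v₁)(x) = R(v₁⁻¹(y))[v′⁻¹(y)(R_{0,y}v′)(x)]·v₁⁻¹(y)(R_{0,y}v₁)(x)`" — an identity
in the group of units (`(R_{0,y}w)(x) = w(x)` at `V₀ = 1`). [cite: Balaban1985Averaging, (182) p.46] -/
theorem eq182 (x : Site d) :
    ((v' * v₁) y)⁻¹ * (v' * v₁) x = Rc (v₁ y)⁻¹ ((v' y)⁻¹ * v' x) * ((v₁ y)⁻¹ * v₁ x) := by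
  simp only [Pi.mul_apply, Rc_apply]
  group

omit [NormedAlgebra ℂ 𝔸] [CompleteSpace 𝔸] in
/-- `cj w (cj w⁻¹ X) = X` (`R(w)R(w⁻¹) = 1`, (57)). [cite: Balaban1985Averaging, (57) p.27] -/
theorem cj_cj_inv (w : 𝔸ˣ) (X : 𝔸) : cj w (cj w⁻¹ X) = X := by
  rw [cj_apply, cj_apply, inv_inv,
    show (w : 𝔸) * (((w⁻¹ : 𝔸ˣ) : 𝔸) * X * w) * ((w⁻¹ : 𝔸ˣ) : 𝔸) =
      ((w : 𝔸) * ((w⁻¹ : 𝔸ˣ) : 𝔸)) * X * ((w : 𝔸) * ((w⁻¹ : 𝔸ˣ) : 𝔸)) by noncomm_ring,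
    Units.mul_inv, one_mul, mul_one]

/-- The remainder of **(183)**: `σ(x) := log[(v′v₁)⁻¹(y)(v′v₁)(x)] − R(v₁⁻¹(y)) log v′⁻¹(y)v′(x) − log v₁⁻¹(y)v₁(x)`, `x = y + r`.
Print (183): "`(1/i) log(v′v₁)⁻¹(y)(R_{0,y}v′v₁)(x) = R(v₁⁻¹(y))(1/i) log v′⁻¹(y)(R_{0,y}v′)(x) + (1/i) log v₁⁻¹(y)(R_{0,y}v₁)(x)
+ O(L²α′₃α′₄)`". [cite: Balaban1985Averaging, (183) p.46] -/
def rem183 (r : Fin d → Fin L) : 𝔸 :=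
  mlog (((((v' * v₁) y)⁻¹ * (v' * v₁) (y + boxVec L r) : 𝔸ˣ)) : 𝔸) -
    (cj (v₁ y)⁻¹ (mlog ((((v' y)⁻¹ * v' (y + boxVec L r) : 𝔸ˣ)) : 𝔸)) +
      mlog ((((v₁ y)⁻¹ * v₁ (y + boxVec L r) : 𝔸ˣ)) : 𝔸))

omit [CompleteSpace 𝔸] in
/-- `rem183_spec`: (183) as an identity. [cite: Balaban1985Averaging, (183) p.46] -/
theorem rem183_spec (r : Fin d → Fin L) :
    mlog (((((v' * v₁) y)⁻¹ * (v' * v₁) (y + boxVec L r) : 𝔸ˣ)) : 𝔸) =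
      cj (v₁ y)⁻¹ (mlog ((((v' y)⁻¹ * v' (y + boxVec L r) : 𝔸ˣ)) : 𝔸)) +
        mlog ((((v₁ y)⁻¹ * v₁ (y + boxVec L r) : 𝔸ˣ)) : 𝔸) + rem183 L v' v₁ y r := by
  rw [rem183]; abel

omit [CompleteSpace 𝔸] in
/-- **(184), the exponent** (summing (183) over the block): `S_{v′v₁}(y) = R(v₁⁻¹(y))S_{v′}(y) + S_{v₁}(y) + Σ_{x∈B(y)}L^{−d}σ(x)`,
`S_g(y) = Σ_{x∈B(y)} L^{−d} log g(y)⁻¹g(x)` the exponent of (78) (`B7Eq99Concrete.Sexp`).  Print (184), first line: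
"`ṽ′(y) = v′(y)v₁(y)exp[iΣ_{x∈B(y)}L^{−d}R(v₁⁻¹(y))(1/i) log v′⁻¹(y)(R_{0,y}v′)(x) + O(L²α′₃α′₄) + …]v₁⁻¹(y)`".
[cite: Balaban1985Averaging, (184) p.46, (78) p.30] -/
theorem Sexp_mul :
    Sexp L (v' * v₁) y = cj (v₁ y)⁻¹ (Sexp L v' y) + Sexp L v₁ y + bmean L (rem183 L v' v₁ y) := by
  rw [Sexp_eq_bmean, Sexp_eq_bmean, Sexp_eq_bmean, ← bmean_cj, ← bmean_add, ← bmean_add]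
  congr 1
  funext r
  rw [rem183_spec]

variable {L v' v₁ y}
variable {p q : ℝ}
  (hp : ∀ r : Fin d → Fin L, ‖((((v' y)⁻¹ * v' (y + boxVec L r) : 𝔸ˣ)) : 𝔸) - 1‖ ≤ p)
  (hq : ∀ r : Fin d → Fin L, ‖((((v₁ y)⁻¹ * v₁ (y + boxVec L r) : 𝔸ˣ)) : 𝔸) - 1‖ ≤ q)
  (hw : ‖((((v₁ y)⁻¹ : 𝔸ˣ)) : 𝔸) - 1‖ ≤ 2 / 5) (hw' : ‖((v₁ y : 𝔸ˣ) : 𝔸) - 1‖ ≤ 2 / 5)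

include hp hq hw hw' in
/-- **(183), kernel form with an explicit constant**: under `‖v′⁻¹(y)v′(x) − 1‖ ≤ p`, `‖v₁⁻¹(y)v₁(x) − 1‖ ≤ q` on the block,
`p, q ≤ 1/50`, and the near-isometry hypotheses `‖v₁(y)^{∓1} − 1‖ ≤ 2/5` (print: `v₁` unitary, `R(v₁⁻¹(y))` an isometry):
`‖σ(x)‖ ≤ 16pq` — BILINEAR ("`O(L²α′₃α′₄)`. A constant in the bound above is an absolute constant" — here `16`, with `p = O(Lα′₄)`,
`q = Lα′₃`).  Proof = print's: the two factors of (182) are `e^{R(v₁⁻¹(y)) log(…)}` and `e^{log(…)}` (norms `≤ 4p`, `2q`), merged by (31).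
[cite: Balaban1985Averaging, (183) p.46, (31) p.22] -/
theorem norm_rem183_le (hp1 : p ≤ 1 / 50) (hq1 : q ≤ 1 / 50) (r : Fin d → Fin L) :
    ‖rem183 L v' v₁ y r‖ ≤ 16 * p * q := by
  have hp0 : 0 ≤ p := (norm_nonneg _).trans (hp r)
  have hq0 : 0 ≤ q := (norm_nonneg _).trans (hq r)
  set x := y + boxVec L r with hx
  set P : 𝔸 := cj (v₁ y)⁻¹ (mlog ((((v' y)⁻¹ * v' x : 𝔸ˣ)) : 𝔸)) with hPd
  set Q : 𝔸 := mlog ((((v₁ y)⁻¹ * v₁ x : 𝔸ˣ)) : 𝔸) with hQd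
  have hm' : ‖mlog ((((v' y)⁻¹ * v' x : 𝔸ˣ)) : 𝔸)‖ ≤ 2 * p :=
    (norm_mlog_le_two_mul ((hp r).trans (by linarith))).trans (by linarith [hp r])
  have hP : ‖P‖ ≤ 4 * p := (norm_cj_le_two_mul hw (by rw [inv_inv]; exact hw') _).trans (by linarith)
  have hQ : ‖Q‖ ≤ 2 * q := (norm_mlog_le_two_mul ((hq r).trans (by linarith))).trans (by linarith [hq r])
  have hPQ : ‖P‖ + ‖Q‖ ≤ 1 / 5 := by linarith
  have hlt' : ‖((((v' y)⁻¹ * v' x : 𝔸ˣ)) : 𝔸) - 1‖ < 1 := lt_of_le_of_lt (hp r) (by linarith)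
  have hlt₁ : ‖((((v₁ y)⁻¹ * v₁ x : 𝔸ˣ)) : 𝔸) - 1‖ < 1 := lt_of_le_of_lt (hq r) (by linarith)
  have hval : (((((v' * v₁) y)⁻¹ * (v' * v₁) x : 𝔸ˣ)) : 𝔸) = exp P * exp Q := by
    rw [eq182, Units.val_mul, val_Rc_eq_cj, hPd, hQd, exp_cj, exp_mlog hlt', exp_mlog hlt₁]
  have hσ : ‖bchRem P Q‖ ≤ 16 * p * q := by
    have h1 : ‖P‖ * ‖Q‖ ≤ 4 * p * ‖Q‖ := mul_le_mul_of_nonneg_right hP (norm_nonneg _)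
    have h2 : 4 * p * ‖Q‖ ≤ 4 * p * (2 * q) := mul_le_mul_of_nonneg_left hQ (by linarith)
    calc ‖bchRem P Q‖ ≤ 2 * ‖P‖ * ‖Q‖ := norm_bchRem_le hPQ
      _ ≤ 16 * p * q := by nlinarith
  have hZ : ‖P + Q + bchRem P Q‖ ≤ 1 / 5 := by
    have h16 : 16 * p * q ≤ 1 / 50 := by nlinarith
    calc ‖P + Q + bchRem P Q‖ ≤ ‖P‖ + ‖Q‖ + ‖bchRem P Q‖ := norm_add₃_le
      _ ≤ 1 / 5 := by linarith
  have hrem : rem183 L v' v₁ y r = bchRem P Q := by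
    rw [rem183, ← hx, hval, exp_mul_exp_eq hPQ, mlog_exp_of_le hZ, hPd, hQd]
    abel
  rw [hrem]
  exact hσ

include hp hq hw hw' in
/-- **(181)–(184), kernel form at `V₀ = 1` with an explicit constant.**  The one-step average of the perturbation,
`ṽ′(y) := {v′v₁}_{B(y)}·({v₁}_{B(y)})⁻¹` ((178)/(179) at `V₀ = 1`, `{·}_{B(y)}` the site average (78) `B7Eq99Concrete.savg`),
satisfies `ṽ′(y) = v′(y)·exp[S_{v′}(y) + Φ]` with `‖Φ‖ ≤ 92pq` under the hypotheses of `norm_rem183_le` — print (184):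
"`ṽ′(y) = … = v′(y)exp[iΣ_{x∈B(y)}L^{−d}(1/i) log v′⁻¹(y)(R_{0,y}v′)(x) + O(L²(α′₃ + α′₄)α′₄)]`".  Proof = print's ("Using (41) and (181),
(183)"): `exp[R(v₁⁻¹(y))S′ + E + S₁] = exp[R(v₁⁻¹(y))S′ + E + Ψ]·exp[S₁]` by the bilinear (41) (`exp_add_eq_exp_mul_exp`,
`‖Ψ‖ ≤ 3·5p·2q`), the factor `exp[S₁]` cancels against `({v₁}_{B(y)})⁻¹ = exp[−S₁]v₁(y)⁻¹`, and `v₁(y)exp[R(v₁⁻¹(y))Z]v₁(y)⁻¹ = exp Z`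
((57)); `Φ = R(v₁(y))(E + Ψ)`.  Every term of `Φ` carries a factor `p` (so `ṽ′ ≡ 1` when `v′ ≡ 1`): no `q²` term.
[cite: Balaban1985Averaging, (181)–(184) p.46, (41) p.23, (57) p.27, (78) p.30] -/
theorem eq184 (hL : 1 ≤ L) (hp1 : p ≤ 1 / 50) (hq1 : q ≤ 1 / 50) :
    ∃ Φ : 𝔸, savg L (v' * v₁) y * (savg L v₁ y)⁻¹ = v' y * expUnit (Sexp L v' y + Φ) ∧ ‖Φ‖ ≤ 92 * p * q := by
  have hp0 : 0 ≤ p := (norm_nonneg _).trans (hp fun _ => ⟨0, hL⟩)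
  have hq0 : 0 ≤ q := (norm_nonneg _).trans (hq fun _ => ⟨0, hL⟩)
  have hS' : ‖Sexp L v' y‖ ≤ 2 * p := by
    rw [Sexp_eq_bmean]
    exact norm_bmean_le hL fun r => (norm_mlog_le_two_mul ((hp r).trans (by linarith))).trans (by linarith [hp r])
  have hS₁ : ‖Sexp L v₁ y‖ ≤ 2 * q := by
    rw [Sexp_eq_bmean]
    exact norm_bmean_le hL fun r => (norm_mlog_le_two_mul ((hq r).trans (by linarith))).trans (by linarith [hq r])
  have hE : ‖bmean L (rem183 L v' v₁ y)‖ ≤ 16 * p * q := norm_bmean_le hL fun r => norm_rem183_le hp hq hw hw' hp1 hq1 r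
  set S' := Sexp L v' y with hS'd
  set S₁ := Sexp L v₁ y with hS₁d
  set E := bmean L (rem183 L v' v₁ y) with hEd
  set X := cj (v₁ y)⁻¹ S' + E with hXd
  have hcS' : ‖cj (v₁ y)⁻¹ S'‖ ≤ 4 * p := (norm_cj_le_two_mul hw (by rw [inv_inv]; exact hw') _).trans (by linarith)
  have hX : ‖X‖ ≤ 5 * p := by
    have h16 : 16 * p * q ≤ p := by nlinarith
    exact (norm_add_le _ _).trans (by linarith)
  have hX' : ‖X‖ ≤ 1 / 10 := hX.trans (by linarith)
  have hS₁' : ‖S₁‖ ≤ 1 / 25 := hS₁.trans (by linarith)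
  obtain ⟨Ψ, hΨ, hΨn⟩ := exp_add_eq_exp_mul_exp hX' hS₁'
  have hΨ' : ‖Ψ‖ ≤ 30 * p * q := by
    have h1 : ‖X‖ * ‖S₁‖ ≤ 5 * p * ‖S₁‖ := mul_le_mul_of_nonneg_right hX (norm_nonneg _)
    have h2 : 5 * p * ‖S₁‖ ≤ 5 * p * (2 * q) := mul_le_mul_of_nonneg_left hS₁ (by linarith)
    nlinarith
  refine ⟨cj (v₁ y) (E + Ψ), ?_, ?_⟩
  · have hSx : Sexp L (v' * v₁) y = X + S₁ := by
      rw [hXd, hS'd, hS₁d, hEd, Sexp_mul]; abel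
    have hu : expUnit (X + S₁) = expUnit (X + Ψ) * expUnit S₁ := by
      apply Units.ext
      simp only [Units.val_mul, val_expUnit]
      exact hΨ
    have hc : Rc (v₁ y) (expUnit (X + Ψ)) = expUnit (S' + cj (v₁ y) (E + Ψ)) := by
      rw [← expUnit_conj, ← cj_apply, hXd, add_assoc, cj_add, cj_cj_inv]
    rw [savg_apply, savg_apply, Pi.mul_apply, hSx, ← hS₁d, hu, ← hc, Rc_apply]
    group
  · calc ‖cj (v₁ y) (E + Ψ)‖ ≤ 2 * ‖E + Ψ‖ := norm_cj_le_two_mul hw' hw _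
      _ ≤ 2 * (‖E‖ + ‖Ψ‖) := by gcongr; exact norm_add_le _ _
      _ ≤ 92 * p * q := by linarith

end Repr

/-! ## §4 The averaged perturbation (178)–(179) and Proposition 9, (199)–(200), at the flat background -/

section Prop9

variable {𝔸 : Type*} [NormedRing 𝔸] [NormedAlgebra ℂ 𝔸] [CompleteSpace 𝔸]

/-- **(179), one step, at `V₀ = 1`, in coarse coordinates**: print's one-step object `ṽ′` of pp. 46–49 ((181)–(184): the average
`\overline{R₀v′v₁}` split as `v′(y)·exp[…]·v₁⁻¹(y)`-corrected, i.e. `ṽ′ = \overline{R₀v′v₁}(\overline{R₀v₁})⁻¹`, which is (179) with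
"`v′ = ũ′ʲ, v₁ = \overline{R₀u₁}ʲ`", p. 49) with `R₀ = id` — `ṽ′(z) := {v′v₁}_{B(Lz)}·({v₁}_{B(Lz)})⁻¹`, `{·}_{B(y)}` the site
average (78) over the block with corner `y = Lz`
(`B7Eq99Concrete.savg`; the unit-lattice point `z ∈ T_η^{(1)} ≅ ℤ^d` labels the block, as in (80) `B7Eq84Concrete.uavg`).
[cite: Balaban1985Averaging, (179) p.45, (181)/(184) p.46, (78)–(80) p.30] -/
def vtil (L : ℕ) (v' v₁ : Site d → 𝔸ˣ) : Site d → 𝔸ˣ :=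
  fun z => savg L (v' * v₁) ((L : ℤ) • z) * (savg L v₁ ((L : ℤ) • z))⁻¹

/-- `vtil_apply`: unfolding. [cite: Balaban1985Averaging, (179) p.45] -/
theorem vtil_apply (L : ℕ) (v' v₁ : Site d → 𝔸ˣ) (z : Site d) :
    vtil L v' v₁ z = savg L (v' * v₁) ((L : ℤ) • z) * (savg L v₁ ((L : ℤ) • z))⁻¹ := rfl

/-- **(178) at `V₀ = 1`**: "`ũ′ʲ = \overline{R₀u′u₁}ʲ(\overline{R₀u₁}ʲ)⁻¹`", `\overline{·}ʲ` the `j`-fold average (80) at `U₀ = 1`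
(`B7Eq84Concrete.uavg L 1`). [cite: Balaban1985Averaging, (178) p.45, (80) p.30] -/
def util (L : ℕ) (u' u₁ : Site d → 𝔸ˣ) (j : ℕ) : Site d → 𝔸ˣ :=
  fun z => uavg L 1 (u' * u₁) j z * (uavg L 1 u₁ j z)⁻¹

/-- `util_apply`: unfolding. [cite: Balaban1985Averaging, (178) p.45] -/
theorem util_apply (L : ℕ) (u' u₁ : Site d → 𝔸ˣ) (j : ℕ) (z : Site d) :
    util L u' u₁ j z = uavg L 1 (u' * u₁) j z * (uavg L 1 u₁ j z)⁻¹ := rfl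

/-- `ũ′⁰ = u′`. [cite: Balaban1985Averaging, (178) p.45] -/
theorem util_zero (L : ℕ) (u' u₁ : Site d → 𝔸ˣ) : util L u' u₁ 0 = u' := by
  funext z
  simp [util_apply, uavg_zero]

/-- **(179) at `V₀ = 1`**: "As in the case of averages `Ũ′ʲ`, it can be easily seen that they may be defined inductively as
`ũ′¹ = ũ′ = \overline{R₀u′u₁}(\overline{R₀u₁})⁻¹, ũ′^{j+1} = \overline{R̄₀ʲũ′ʲ\overline{R₀u₁}ʲ}(\overline{R̄₀ʲ\overline{R₀u₁}ʲ})⁻¹`" — the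
recursion: one step `vtil` with `v′ = ũ′ʲ`, `v₁ = \overline{u₁}ʲ` (at `U₀ = 1`, `R̄₀ʲ = id` and `\overline{R̄₀ʲ\overline{R₀u₁}ʲ} = \overline{u₁}^{j+1}`).
[cite: Balaban1985Averaging, (179) p.45] -/
theorem util_succ (L : ℕ) (u' u₁ : Site d → 𝔸ˣ) (j : ℕ) :
    util L u' u₁ (j + 1) = vtil L (util L u' u₁ j) (uavg L 1 u₁ j) := by
  have hmul : util L u' u₁ j * uavg L 1 u₁ j = uavg L 1 (u' * u₁) j := by
    funext x
    simp [util_apply]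
  funext z
  rw [util_apply, vtil_apply, hmul, uavg_succ_one_left, uavg_succ_one_left]

/-- The constant `C′₅` of (200), explicit: `C′₅ = 64(d + 1)` (print: "`C′₅`"; it grows with the dimension through the
length `≤ dL` of the block contours `Γ_{y,x}`). [cite: Balaban1985Averaging, Proposition 9 p.49] -/
def C5' (d : ℕ) : ℝ := 64 * ((d : ℝ) + 1)

/-- The constant `C′₄` of (199), explicit: `C′₄ = 10⁴(d + 1)²`. [cite: Balaban1985Averaging, Proposition 9 p.49] -/
def C4' (d : ℕ) : ℝ := 10000 * ((d : ℝ) + 1) ^ 2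

omit [CompleteSpace 𝔸] in
/-- A linear combination of block means. [folklore] -/
theorem bmean_lin {L : ℕ} (hL : 1 ≤ L) (f g : (Fin d → Fin L) → 𝔸) (c : 𝔸) :
    bmean L (fun r => f r - g r + c) = bmean L f - bmean L g + c := by
  simp only [bmean_apply, smul_add, smul_sub, Finset.sum_add_distrib, Finset.sum_sub_distrib, ← Finset.sum_smul,
    sum_weights L hL, one_smul]

omit [NormedAlgebra ℂ 𝔸] [CompleteSpace 𝔸] in
/-- The straight word of `L` bonds in direction `μ` has length `L`. [folklore] -/
theorem length_seg_nat (μ : Fin d) (L : ℕ) : (seg μ (L : ℤ)).length = L := by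
  rw [seg_natCast, List.length_replicate]

/-- **(182)/(187) on a block**: under `V′_b = e^{A_b}`, `‖A_b‖ ≤ a`, `(d+1)La ≤ θ ≤ 1/64`, for the tree contour `Γ_{y,x}`,
`x = y + r ∈ B(y)` (`|Γ_{y,x}| ≤ dL`): `‖v′(y)⁻¹v′(x) − 1‖ ≤ 2θ` (print (182): "`< |Γ_{y,x}|α′₄e^{|Γ_{y,x}|α′₄} = O(Lα′₄)`"),
`‖log v′(y)⁻¹v′(x)‖ ≤ 4θ`, `‖log v′(y)⁻¹v′(x) − A(Γ_{y,x})‖ ≤ 17θ²` (print (187)), `‖A(Γ_{y,x})‖ ≤ θ`.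
[cite: Balaban1985Averaging, (182) p.46, (187) p.47] -/
theorem block_walk {v : Site d → 𝔸ˣ} {a θ : ℝ} {L : ℕ} (ha0 : 0 ≤ a)
    (hVA : ∀ (x : Site d) (κ : Fin d), ((Vb v x κ : 𝔸ˣ) : 𝔸) = exp (Ab v x κ) ∧ ‖Ab v x κ‖ ≤ a)
    (hθ0 : 0 ≤ θ) (hθ1 : θ ≤ 1 / 64) (hLa : ((d : ℝ) + 1) * L * a ≤ θ) (y : Site d) (r : Fin d → Fin L) :
    ‖((((v y)⁻¹ * v (y + boxVec L r) : 𝔸ˣ)) : 𝔸) - 1‖ ≤ 2 * θ ∧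
      ‖mlog ((((v y)⁻¹ * v (y + boxVec L r) : 𝔸ˣ)) : 𝔸)‖ ≤ 4 * θ ∧
      ‖mlog ((((v y)⁻¹ * v (y + boxVec L r) : 𝔸ˣ)) : 𝔸) - asum (Ab v) y (treeWord (boxVec L r))‖ ≤ 17 * θ ^ 2 ∧
      ‖asum (Ab v) y (treeWord (boxVec L r))‖ ≤ θ := by
  have hlen : ((treeWord (boxVec L r)).length : ℝ) * a ≤ θ := by
    rw [length_treeWord]
    have h1 : (l1 (boxVec L r) : ℝ) ≤ d * L := by exact_mod_cast l1_boxVec_le L r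
    have h2 : (0 : ℝ) ≤ L * a := by positivity
    calc (l1 (boxVec L r) : ℝ) * a ≤ (d * L : ℝ) * a := mul_le_mul_of_nonneg_right h1 ha0
      _ ≤ θ := by nlinarith
  have h := walk_log ha0 hVA hθ0 hθ1 y (treeWord (boxVec L r)) hlen
  rwa [disp_treeWord] at h

/-- **(186)–(188) on a coarse bond**: for the straight word `c` of `L` bonds from `y` in direction `μ` (print: the bond
`c = ⟨y, y′⟩ ∈ T_{L^{-1}}`, `y′ = y + Le_μ`): `‖v′(y)⁻¹v′(y′) − 1‖ ≤ 2θ`, `‖log v′(y)⁻¹v′(y′)‖ ≤ 4θ`,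
`‖log v′(y)⁻¹v′(y′) − A(c)‖ ≤ 17θ²` (print, p. 47 between (188) and (189): "Further we can write
`v′⁻¹(c₋)R(V₀(c))v′(c₊) = (R_{0,c₋}V′)(c) = 1 + i(R_{0,c₋}A)(c) + O((Lα′₄)²)`" — at `V₀ = 1`, `R(V₀(c)) = id`), `‖A(c)‖ ≤ θ`.
[cite: Balaban1985Averaging, (186) p.46, (187)–(189) p.47] -/
theorem seg_walk {v : Site d → 𝔸ˣ} {a θ : ℝ} {L : ℕ} (ha0 : 0 ≤ a)
    (hVA : ∀ (x : Site d) (κ : Fin d), ((Vb v x κ : 𝔸ˣ) : 𝔸) = exp (Ab v x κ) ∧ ‖Ab v x κ‖ ≤ a)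
    (hθ0 : 0 ≤ θ) (hθ1 : θ ≤ 1 / 64) (hLa : ((d : ℝ) + 1) * L * a ≤ θ) (y : Site d) (μ : Fin d) :
    ‖((((v y)⁻¹ * v (y + (L : ℤ) • e μ) : 𝔸ˣ)) : 𝔸) - 1‖ ≤ 2 * θ ∧
      ‖mlog ((((v y)⁻¹ * v (y + (L : ℤ) • e μ) : 𝔸ˣ)) : 𝔸)‖ ≤ 4 * θ ∧
      ‖mlog ((((v y)⁻¹ * v (y + (L : ℤ) • e μ) : 𝔸ˣ)) : 𝔸) - asum (Ab v) y (seg μ (L : ℤ))‖ ≤ 17 * θ ^ 2 ∧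
      ‖asum (Ab v) y (seg μ (L : ℤ))‖ ≤ θ := by
  have hlen : ((seg μ (L : ℤ)).length : ℝ) * a ≤ θ := by
    rw [length_seg_nat]
    have h2 : (0 : ℝ) ≤ d * (L * a) := by positivity
    nlinarith
  have h := walk_log ha0 hVA hθ0 hθ1 y (seg μ (L : ℤ)) hlen
  rwa [disp_seg] at h

/-- **(193)–(195) on a block**: the closed contour `Γ_{y,x} ∪ [x,x′] ∪ (−Γ_{y′,x′}) ∪ (−c)` of (191)–(192) (length
`≤ 2(d+1)L`) has `‖A(loop)‖ ≤ 4θ²` under `(d+1)La ≤ θ ≤ 1/128` (print (193)–(195): "`(R_{0,c₋}A)(Γ_{c,x} ∪ (−c)) =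
(1/i) log(R_{0,c₋}V′)(Γ_{c,x} ∪ (−c)) + O((Lα′₄)²)`, (193) … `= 1 + O(L²α₀α₄)`, (194) hence `(R_{0,c₋}A)(Γ_{c,x} ∪ (−c)) =
O(L²(α₀α₄ + α′₄²))`. (195)"; at `V₀ = 1` only the `α′₄²`-term). [cite: Balaban1985Averaging, (193)–(195) p.48] -/
theorem loop_walk {v : Site d → 𝔸ˣ} {a θ : ℝ} {L : ℕ} (ha0 : 0 ≤ a)
    (hVA : ∀ (x : Site d) (κ : Fin d), ((Vb v x κ : 𝔸ˣ) : 𝔸) = exp (Ab v x κ) ∧ ‖Ab v x κ‖ ≤ a)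
    (hθ0 : 0 ≤ θ) (hθ1 : θ ≤ 1 / 128) (hLa : ((d : ℝ) + 1) * L * a ≤ θ) (y : Site d) (r : Fin d → Fin L) (μ : Fin d) :
    ‖asum (Ab v) y (treeWord (boxVec L r) ++ seg μ (L : ℤ) ++ revWord (treeWord (boxVec L r)) ++ revWord (seg μ (L : ℤ)))‖
      ≤ 4 * θ ^ 2 := by
  have hlen : ((treeWord (boxVec L r) ++ seg μ (L : ℤ) ++ revWord (treeWord (boxVec L r)) ++
      revWord (seg μ (L : ℤ))).length : ℝ) * a ≤ 2 * θ := by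
    simp only [List.length_append, length_revWord, length_treeWord, length_seg_nat, Nat.cast_add]
    have h1 : (l1 (boxVec L r) : ℝ) ≤ d * L := by exact_mod_cast l1_boxVec_le L r
    have h2 : (0 : ℝ) ≤ L * a := by positivity
    have h3 : (l1 (boxVec L r) : ℝ) * a ≤ (d * L : ℝ) * a := mul_le_mul_of_nonneg_right h1 ha0
    nlinarith
  have hdisp : disp (treeWord (boxVec L r) ++ seg μ (L : ℤ) ++ revWord (treeWord (boxVec L r)) ++
      revWord (seg μ (L : ℤ))) = 0 := by
    simp only [disp_append, disp_revWord, disp_treeWord, disp_seg]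
    abel
  have h := norm_asum_loop_le ha0 hVA (θ := 2 * θ) (by positivity) (by linarith) y _ hlen hdisp
  calc _ ≤ (2 * θ) ^ 2 := h
    _ = 4 * θ ^ 2 := by ring

/-- **(200), the core estimate at one block** (print: "`|ṽ′(y) − 1| < α₄ + C′₅Lα′₄`"): with `θ ≥ (d+1)La` as in `block_walk`
(`θ ≤ 1/500`), `‖v₁(y)⁻¹v₁(x) − 1‖ ≤ q ≤ 1/50` on the block and `‖v′(y) − 1‖ ≤ α₄ ≤ 1`:
`‖ṽ′ − 1‖ ≤ α₄ + 16θ + 736θq` (from (184): `ṽ′ = v′(y)e^{S′+Φ}`, `‖S′‖ ≤ 4θ`, `‖Φ‖ ≤ 184θq`).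
[cite: Balaban1985Averaging, (200) p.49, (184) p.46] -/
theorem core200 {L : ℕ} (hL : 1 ≤ L) {v' v₁ : Site d → 𝔸ˣ} {a θ q α₄ : ℝ} (ha0 : 0 ≤ a)
    (hVA : ∀ (x : Site d) (κ : Fin d), ((Vb v' x κ : 𝔸ˣ) : 𝔸) = exp (Ab v' x κ) ∧ ‖Ab v' x κ‖ ≤ a)
    (hθ0 : 0 ≤ θ) (hθ1 : θ ≤ 1 / 500) (hLa : ((d : ℝ) + 1) * L * a ≤ θ)
    (hw : ∀ x, ‖((((v₁ x)⁻¹ : 𝔸ˣ)) : 𝔸) - 1‖ ≤ 2 / 5) (hw' : ∀ x, ‖((v₁ x : 𝔸ˣ) : 𝔸) - 1‖ ≤ 2 / 5)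
    (hq1 : q ≤ 1 / 50) (hα₄ : α₄ ≤ 1) (y : Site d)
    (hq : ∀ r : Fin d → Fin L, ‖((((v₁ y)⁻¹ * v₁ (y + boxVec L r) : 𝔸ˣ)) : 𝔸) - 1‖ ≤ q)
    (h4a : ‖((v' y : 𝔸ˣ) : 𝔸) - 1‖ ≤ α₄) :
    ‖(((savg L (v' * v₁) y * (savg L v₁ y)⁻¹ : 𝔸ˣ)) : 𝔸) - 1‖ ≤ α₄ + 16 * θ + 736 * θ * q := by
  have hq0 : 0 ≤ q := (norm_nonneg _).trans (hq fun _ => ⟨0, hL⟩)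
  have hθ64 : θ ≤ 1 / 64 := hθ1.trans (by norm_num)
  have hb := block_walk ha0 hVA hθ0 hθ64 hLa
  obtain ⟨Φ, hΦ, hΦn⟩ := eq184 (fun r => (hb y r).1) hq (hw y) (hw' y) hL (by linarith) hq1
  have hS : ‖Sexp L v' y‖ ≤ 4 * θ := by
    rw [Sexp_eq_bmean]; exact norm_bmean_le hL fun r => (hb y r).2.1
  have hΦ1 : ‖Φ‖ ≤ 184 * θ * q := hΦn.trans (by linarith)
  have hqθ : 184 * θ * q ≤ 4 * θ := by nlinarith
  have hM : ‖Sexp L v' y + Φ‖ ≤ 4 * θ + 184 * θ * q := (norm_add_le _ _).trans (add_le_add hS hΦ1)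
  have hm : ‖exp (Sexp L v' y + Φ) - 1‖ ≤ 2 * (4 * θ + 184 * θ * q) :=
    (B7Transfer.norm_exp_sub_one_le_of_le _ hM).trans
      (exp_sub_one_le_two_mul_of_le (by positivity) le_rfl (by linarith))
  rw [hΦ, Units.val_mul, val_expUnit]
  have h1 := B7Prop6Bound.mul_sub_one_norm_le ((v' y : 𝔸ˣ) : 𝔸) (exp (Sexp L v' y + Φ))
  have hA0 := norm_nonneg (((v' y : 𝔸ˣ) : 𝔸) - 1)
  have hB0 := norm_nonneg (exp (Sexp L v' y + Φ) - 1)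
  have hAB : ‖((v' y : 𝔸ˣ) : 𝔸) - 1‖ * ‖exp (Sexp L v' y + Φ) - 1‖ ≤ 1 * ‖exp (Sexp L v' y + Φ) - 1‖ :=
    mul_le_mul_of_nonneg_right (h4a.trans hα₄) hB0
  have hid : (1 + ‖((v' y : 𝔸ˣ) : 𝔸) - 1‖) * (1 + ‖exp (Sexp L v' y + Φ) - 1‖) - 1 =
      ‖((v' y : 𝔸ˣ) : 𝔸) - 1‖ + ‖exp (Sexp L v' y + Φ) - 1‖ +
        ‖((v' y : 𝔸ˣ) : 𝔸) - 1‖ * ‖exp (Sexp L v' y + Φ) - 1‖ := by ring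
  linarith

/-- **(199), the core estimate at one coarse bond** (print: "`|ṽ′⁻¹(c₋)R̄_{0,c}ṽ′(c₊) − 1| < Lα′₄ + C′₄L²(α₀α₄ + α′₃α′₄ + α′₄²)`",
`c = ⟨y, y′⟩`, `y′ = y + Le_μ`; at `V₀ = 1`, `R̄_{0,c} = id` and `α₀ = 0`): with `θ ≥ (d+1)La`, `θ ≤ 1/500`, the block
hypothesis `‖v₁(·)⁻¹v₁(x) − 1‖ ≤ q ≤ 1/50` at both corners: `‖ṽ′(y)⁻¹ṽ′(y′) − 1‖ ≤ La + 2300θ² + 368θq` — the LEADING TERM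
`La` (`≤ Lα′₄(1 + 4α′₄)`) is print's `Lα′₄` with coefficient exactly one (it is `|Σ_{x∈B(y)}L^{−d}A([x,x′])| ≤ L·sup|A_b|`, the
main term of (192)/(196)); the error is second order and carries no `q²`.  Proof = print's pp. 47–49 at `V₀ = 1`: (184) at `y`
and `y′`, (186)–(188) for `v′(y)⁻¹v′(y′) = e^{A(c) + O(θ²)}`, the three exponentials merged by (31) (`exp_mul3_eq`), the linear
terms `−S′(y) + A(c) + S′(y′)` rearranged by (189)–(192) into `Σ L^{−d}[A([x,x′]) − A(loop_x)]` (`asum_loop`, `bmean_lin`), the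
loops bounded by (193)–(195) (`loop_walk`), and `|e^M − 1| ≤ |M| + |M|²`. [cite: Balaban1985Averaging, (199) p.49, (185)–(198) pp.46–49] -/
theorem core199 {L : ℕ} (hL : 1 ≤ L) {v' v₁ : Site d → 𝔸ˣ} {a θ q : ℝ} (ha0 : 0 ≤ a)
    (hVA : ∀ (x : Site d) (κ : Fin d), ((Vb v' x κ : 𝔸ˣ) : 𝔸) = exp (Ab v' x κ) ∧ ‖Ab v' x κ‖ ≤ a)
    (hθ0 : 0 ≤ θ) (hθ1 : θ ≤ 1 / 500) (hLa : ((d : ℝ) + 1) * L * a ≤ θ)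
    (hw : ∀ x, ‖((((v₁ x)⁻¹ : 𝔸ˣ)) : 𝔸) - 1‖ ≤ 2 / 5) (hw' : ∀ x, ‖((v₁ x : 𝔸ˣ) : 𝔸) - 1‖ ≤ 2 / 5)
    (hq1 : q ≤ 1 / 50) (y : Site d) (μ : Fin d)
    (hq : ∀ r : Fin d → Fin L, ‖((((v₁ y)⁻¹ * v₁ (y + boxVec L r) : 𝔸ˣ)) : 𝔸) - 1‖ ≤ q)
    (hq' : ∀ r : Fin d → Fin L,
      ‖((((v₁ (y + (L : ℤ) • e μ))⁻¹ * v₁ (y + (L : ℤ) • e μ + boxVec L r) : 𝔸ˣ)) : 𝔸) - 1‖ ≤ q) :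
    ‖((((savg L (v' * v₁) y * (savg L v₁ y)⁻¹)⁻¹ *
        (savg L (v' * v₁) (y + (L : ℤ) • e μ) * (savg L v₁ (y + (L : ℤ) • e μ))⁻¹) : 𝔸ˣ)) : 𝔸) - 1‖
      ≤ L * a + 2300 * θ ^ 2 + 368 * θ * q := by
  have hq0 : 0 ≤ q := (norm_nonneg _).trans (hq fun _ => ⟨0, hL⟩)
  have hθ64 : θ ≤ 1 / 64 := hθ1.trans (by norm_num)
  have hLa' : (L : ℝ) * a ≤ θ := by
    have : (0 : ℝ) ≤ d * (L * a) := by positivity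
    nlinarith
  set y' := y + (L : ℤ) • e μ with hy'
  have hb := block_walk ha0 hVA hθ0 hθ64 hLa
  obtain ⟨hc1, hc2, hc3, -⟩ := seg_walk ha0 hVA hθ0 hθ64 hLa y μ
  rw [← hy'] at hc1 hc2 hc3
  -- (184) at the two corners
  obtain ⟨Φ, hΦ, hΦn⟩ := eq184 (fun r => (hb y r).1) hq (hw y) (hw' y) hL (by linarith) hq1
  obtain ⟨Φ', hΦ', hΦ'n⟩ := eq184 (fun r => (hb y' r).1) hq' (hw y') (hw' y') hL (by linarith) hq1
  have hS : ‖Sexp L v' y‖ ≤ 4 * θ := by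
    rw [Sexp_eq_bmean]; exact norm_bmean_le hL fun r => (hb y r).2.1
  have hS' : ‖Sexp L v' y'‖ ≤ 4 * θ := by
    rw [Sexp_eq_bmean]; exact norm_bmean_le hL fun r => (hb y' r).2.1
  set φ := 184 * θ * q with hφd
  have hΦ1 : ‖Φ‖ ≤ φ := hΦn.trans (by rw [hφd]; linarith)
  have hΦ'1 : ‖Φ'‖ ≤ φ := hΦ'n.trans (by rw [hφd]; linarith)
  have hφ0 : 0 ≤ φ := by rw [hφd]; positivity
  have hφθ : φ ≤ 4 * θ := by rw [hφd]; nlinarith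
  -- the three exponents
  have hB₁ : ‖-(Sexp L v' y + Φ)‖ ≤ 4 * θ + φ := by
    rw [norm_neg]; exact (norm_add_le _ _).trans (add_le_add hS hΦ1)
  have hB₃ : ‖Sexp L v' y' + Φ'‖ ≤ 4 * θ + φ := (norm_add_le _ _).trans (add_le_add hS' hΦ'1)
  have hsum : ‖-(Sexp L v' y + Φ)‖ + ‖mlog ((((v' y)⁻¹ * v' y' : 𝔸ˣ)) : 𝔸)‖ + ‖Sexp L v' y' + Φ'‖ ≤ 12 * θ + 2 * φ := by
    linarith
  have hs20 : 12 * θ + 2 * φ ≤ 1 / 20 := by linarith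
  obtain ⟨ρ, hρ, hρn⟩ := exp_mul3_eq hsum hs20
  have hρ' : ‖ρ‖ ≤ 2000 * θ ^ 2 := by
    have h0 : 0 ≤ 12 * θ + 2 * φ := by positivity
    have h1 : (12 * θ + 2 * φ) ^ 2 ≤ (20 * θ) ^ 2 := pow_le_pow_left₀ h0 (by linarith) 2
    nlinarith
  -- the value of the quotient
  have hWlt : ‖((((v' y)⁻¹ * v' y' : 𝔸ˣ)) : 𝔸) - 1‖ < 1 := lt_of_le_of_lt hc1 (by linarith)
  have hWexp : ((((v' y)⁻¹ * v' y' : 𝔸ˣ)) : 𝔸) = exp (mlog ((((v' y)⁻¹ * v' y' : 𝔸ˣ)) : 𝔸)) := (exp_mlog hWlt).symm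
  have hquot : (savg L (v' * v₁) y * (savg L v₁ y)⁻¹)⁻¹ * (savg L (v' * v₁) y' * (savg L v₁ y')⁻¹) =
      (expUnit (Sexp L v' y + Φ))⁻¹ * ((v' y)⁻¹ * v' y') * expUnit (Sexp L v' y' + Φ') := by
    rw [hΦ, hΦ']; group
  rw [hquot, val_inv_expUnit, Units.val_mul, Units.val_mul, val_expUnit, val_expUnit, hWexp, hρ]
  -- the exponent, rearranged by (189)–(192)
  set M := -(Sexp L v' y + Φ) + mlog ((((v' y)⁻¹ * v' y' : 𝔸ˣ)) : 𝔸) + (Sexp L v' y' + Φ') + ρ with hMd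
  have hMid : M = bmean L (fun r => asum (Ab v') (y + boxVec L r) (seg μ (L : ℤ)) -
        asum (Ab v') y (treeWord (boxVec L r) ++ seg μ (L : ℤ) ++ revWord (treeWord (boxVec L r)) ++
          revWord (seg μ (L : ℤ))) +
        ((mlog ((((v' y')⁻¹ * v' (y' + boxVec L r) : 𝔸ˣ)) : 𝔸) - asum (Ab v') y' (treeWord (boxVec L r))) -
         (mlog ((((v' y)⁻¹ * v' (y + boxVec L r) : 𝔸ˣ)) : 𝔸) - asum (Ab v') y (treeWord (boxVec L r))))) +
      (mlog ((((v' y)⁻¹ * v' y' : 𝔸ˣ)) : 𝔸) - asum (Ab v') y (seg μ (L : ℤ))) + (Φ' - Φ) + ρ := by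
    have hpt : (fun r => asum (Ab v') (y + boxVec L r) (seg μ (L : ℤ)) -
        asum (Ab v') y (treeWord (boxVec L r) ++ seg μ (L : ℤ) ++ revWord (treeWord (boxVec L r)) ++
          revWord (seg μ (L : ℤ))) +
        ((mlog ((((v' y')⁻¹ * v' (y' + boxVec L r) : 𝔸ˣ)) : 𝔸) - asum (Ab v') y' (treeWord (boxVec L r))) -
         (mlog ((((v' y)⁻¹ * v' (y + boxVec L r) : 𝔸ˣ)) : 𝔸) - asum (Ab v') y (treeWord (boxVec L r))))) =
        (fun r => mlog ((((v' y')⁻¹ * v' (y' + boxVec L r) : 𝔸ˣ)) : 𝔸) -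
          mlog ((((v' y)⁻¹ * v' (y + boxVec L r) : 𝔸ˣ)) : 𝔸) + asum (Ab v') y (seg μ (L : ℤ))) := by
      funext r
      rw [asum_loop, disp_treeWord, disp_seg, ← hy']
      abel
    rw [hpt, bmean_lin hL, ← Sexp_eq_bmean, ← Sexp_eq_bmean, hMd]
    abel
  -- sizes of the pieces
  have hmain : ∀ r : Fin d → Fin L, ‖asum (Ab v') (y + boxVec L r) (seg μ (L : ℤ))‖ ≤ L * a := by
    intro r
    have h := norm_asum_le (Ab v') (y + boxVec L r) (l1 (y + boxVec L r - (y + boxVec L r)) + (seg μ (L : ℤ)).length)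
      ha0 (fun x κ _ => (hVA x κ).2) (seg μ (L : ℤ)) (y + boxVec L r) le_rfl
    rwa [length_seg_nat] at h
  have hloop : ∀ r : Fin d → Fin L, ‖asum (Ab v') y (treeWord (boxVec L r) ++ seg μ (L : ℤ) ++
      revWord (treeWord (boxVec L r)) ++ revWord (seg μ (L : ℤ)))‖ ≤ 4 * θ ^ 2 :=
    fun r => loop_walk ha0 hVA hθ0 (hθ1.trans (by norm_num)) hLa y r μ
  have hG : ‖bmean L (fun r => asum (Ab v') (y + boxVec L r) (seg μ (L : ℤ)) -
        asum (Ab v') y (treeWord (boxVec L r) ++ seg μ (L : ℤ) ++ revWord (treeWord (boxVec L r)) ++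
          revWord (seg μ (L : ℤ))) +
        ((mlog ((((v' y')⁻¹ * v' (y' + boxVec L r) : 𝔸ˣ)) : 𝔸) - asum (Ab v') y' (treeWord (boxVec L r))) -
         (mlog ((((v' y)⁻¹ * v' (y + boxVec L r) : 𝔸ˣ)) : 𝔸) - asum (Ab v') y (treeWord (boxVec L r)))))‖ ≤
      L * a + 4 * θ ^ 2 + (17 * θ ^ 2 + 17 * θ ^ 2) := by
    refine norm_bmean_le hL fun r => ?_
    refine (norm_add_le _ _).trans (add_le_add ((norm_sub_le _ _).trans (add_le_add (hmain r) (hloop r))) ?_)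
    exact (norm_sub_le _ _).trans (add_le_add (hb y' r).2.2.1 (hb y r).2.2.1)
  have hΦΦ : ‖Φ' - Φ‖ ≤ 2 * φ := (norm_sub_le _ _).trans (by linarith)
  have hM1 : ‖M‖ ≤ L * a + 2055 * θ ^ 2 + 2 * φ := by
    rw [hMid]
    refine (norm_add_le _ _).trans ?_
    refine (add_le_add ((norm_add₃_le).trans (add_le_add (add_le_add hG hc3) hΦΦ)) hρ').trans ?_
    linarith
  have hM2 : ‖M‖ ≤ 14 * θ := by nlinarith
  have hM3 : |‖M‖| ≤ 1 := by rw [abs_of_nonneg (norm_nonneg _)]; linarith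
  have hexp : ‖exp M - 1‖ ≤ ‖M‖ + ‖M‖ ^ 2 := by
    have h1 := B7Transfer.norm_exp_sub_one_le_of_le M le_rfl
    have h2 := Real.abs_exp_sub_one_sub_id_le hM3
    have h3 := le_abs_self (Real.exp ‖M‖ - 1 - ‖M‖)
    linarith
  have hMsq : ‖M‖ ^ 2 ≤ (14 * θ) ^ 2 := pow_le_pow_left₀ (norm_nonneg _) hM2 2
  have hφq : 2 * φ = 368 * θ * q := by rw [hφd]; ring
  nlinarith


/-! ## §5 Proposition 9 (flat background), assembled in print's parameters -/

/-- The smallness bookkeeping of Proposition 9 ("`α₀, α₃, α′₃, α₄, α′₄ ≦ c′₆`"; here `c′₆` depends on `d` and `L`): from (180b)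
and `10³(d+1)Lα′₄ ≤ 1` — `V′_b = e^{A_b}` with `‖A_b‖ ≤ a := α′₄ + 4α′₄² ≤ 2α′₄`, and `θ := (d+1)La ≤ 2(d+1)Lα′₄ ≤ 1/500`.
[cite: Balaban1985Averaging, Proposition 9 p.49, (185) p.46] -/
theorem setup {v' : Site d → 𝔸ˣ} {α₄' : ℝ} {L : ℕ} (hL : 1 ≤ L) (h4b : BondBd v' α₄') (hα0 : 0 ≤ α₄')
    (hs : 1000 * ((d : ℝ) + 1) * L * α₄' ≤ 1) :
    (∀ (x : Site d) (κ : Fin d), ((Vb v' x κ : 𝔸ˣ) : 𝔸) = exp (Ab v' x κ) ∧ ‖Ab v' x κ‖ ≤ α₄' + 4 * α₄' ^ 2) ∧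
      4 * α₄' ≤ 1 ∧ 0 ≤ α₄' + 4 * α₄' ^ 2 ∧ α₄' + 4 * α₄' ^ 2 ≤ 2 * α₄' ∧
      0 ≤ ((d : ℝ) + 1) * L * (α₄' + 4 * α₄' ^ 2) ∧ ((d : ℝ) + 1) * L * (α₄' + 4 * α₄' ^ 2) ≤ 1 / 500 ∧
      ((d : ℝ) + 1) * L * (α₄' + 4 * α₄' ^ 2) ≤ 2 * (((d : ℝ) + 1) * L * α₄') := by
  have hL' : (1 : ℝ) ≤ L := by exact_mod_cast hL
  have hK : (1 : ℝ) ≤ (d : ℝ) + 1 := by have := Nat.cast_nonneg (α := ℝ) d; linarith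
  have hKL : (1 : ℝ) ≤ ((d : ℝ) + 1) * L := one_le_mul_of_one_le_of_one_le hK hL'
  have hKL0 : (0 : ℝ) ≤ ((d : ℝ) + 1) * L := by positivity
  have h1 : α₄' ≤ ((d : ℝ) + 1) * L * α₄' := le_mul_of_one_le_left hα0 hKL
  have h4 : 4 * α₄' ≤ 1 := by nlinarith
  have ha2 : α₄' + 4 * α₄' ^ 2 ≤ 2 * α₄' := by nlinarith [mul_le_mul_of_nonneg_left h4 hα0]
  have hθ2 : ((d : ℝ) + 1) * L * (α₄' + 4 * α₄' ^ 2) ≤ 2 * (((d : ℝ) + 1) * L * α₄') := by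
    have := mul_le_mul_of_nonneg_left ha2 hKL0
    linarith
  refine ⟨Vb_exp_data (by linarith) h4b, h4, by positivity, ha2, by positivity, ?_, hθ2⟩
  nlinarith

/-- The arithmetic of (199): with `K = d + 1 ≥ 1`, `L ≥ 1`, `t = α′₄ ∈ [0, ¼]`, `q = Lα′₃ ≥ 0`, `a = t + 4t²`, `θ = KLa`:
`La + 2300θ² + 368θq ≤ Lt + 10⁴K²(Lqt + L²t²)`. [folklore] -/
theorem arith199 {K L t q : ℝ} (hK : 1 ≤ K) (hL : 1 ≤ L) (ht0 : 0 ≤ t) (h4t : 4 * t ≤ 1) (hq0 : 0 ≤ q) :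
    L * (t + 4 * t ^ 2) + 2300 * (K * L * (t + 4 * t ^ 2)) ^ 2 + 368 * (K * L * (t + 4 * t ^ 2)) * q ≤
      L * t + 10000 * K ^ 2 * (L * q * t + L ^ 2 * t ^ 2) := by
  have ha2 : t + 4 * t ^ 2 ≤ 2 * t := by nlinarith [mul_le_mul_of_nonneg_left h4t ht0]
  have hKL : 0 ≤ K * L := mul_nonneg (by linarith) (by linarith)
  have hθle : K * L * (t + 4 * t ^ 2) ≤ 2 * (K * L * t) := by nlinarith [mul_le_mul_of_nonneg_left ha2 hKL]
  have hθ0 : 0 ≤ K * L * (t + 4 * t ^ 2) := mul_nonneg hKL (by positivity)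
  have hθsq : (K * L * (t + 4 * t ^ 2)) ^ 2 ≤ (2 * (K * L * t)) ^ 2 := pow_le_pow_left₀ hθ0 hθle 2
  have hθq : K * L * (t + 4 * t ^ 2) * q ≤ 2 * (K * L * t) * q := mul_le_mul_of_nonneg_right hθle hq0
  have hLL : L ≤ L ^ 2 := by nlinarith
  have h1 : L * (4 * t ^ 2) ≤ L ^ 2 * (4 * t ^ 2) := mul_le_mul_of_nonneg_right hLL (by positivity)
  have hK2 : K ≤ K ^ 2 := by nlinarith
  have hK21 : 1 ≤ K ^ 2 := by nlinarith
  have hL0 : 0 ≤ L := by linarith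
  have hLqt : 0 ≤ L * q * t := mul_nonneg (mul_nonneg hL0 hq0) ht0
  have hL2t2 : 0 ≤ L ^ 2 * t ^ 2 := by positivity
  have h2 : K * (L * q * t) ≤ K ^ 2 * (L * q * t) := mul_le_mul_of_nonneg_right hK2 hLqt
  have h3 : L ^ 2 * t ^ 2 ≤ K ^ 2 * (L ^ 2 * t ^ 2) := le_mul_of_one_le_left hL2t2 hK21
  have h4 : 0 ≤ K ^ 2 * (L * q * t) := mul_nonneg (by positivity) hLqt
  nlinarith [hθsq, hθq, h1, h2, h3, h4]

/-- The arithmetic of (200): `16θ + 736θq ≤ 64KLt` for `q ≤ 1/50`. [folklore] -/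
theorem arith200 {K L t q : ℝ} (hK : 1 ≤ K) (hL : 1 ≤ L) (ht0 : 0 ≤ t) (h4t : 4 * t ≤ 1) (hq1 : q ≤ 1 / 50) :
    16 * (K * L * (t + 4 * t ^ 2)) + 736 * (K * L * (t + 4 * t ^ 2)) * q ≤ 64 * K * L * t := by
  have ha2 : t + 4 * t ^ 2 ≤ 2 * t := by nlinarith [mul_le_mul_of_nonneg_left h4t ht0]
  have hKL : 0 ≤ K * L := mul_nonneg (by linarith) (by linarith)
  have hθle : K * L * (t + 4 * t ^ 2) ≤ 2 * (K * L * t) := by nlinarith [mul_le_mul_of_nonneg_left ha2 hKL]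
  have hθ0 : 0 ≤ K * L * (t + 4 * t ^ 2) := mul_nonneg hKL (by positivity)
  have h1 : 736 * (K * L * (t + 4 * t ^ 2)) * q ≤ 15 * (K * L * (t + 4 * t ^ 2)) := by
    nlinarith [mul_le_mul_of_nonneg_left hq1 hθ0]
  have hKLt : 0 ≤ K * L * t := mul_nonneg hKL ht0
  nlinarith

/-- **Proposition 9 at the flat background `V₀ = 1`** (p. 49): "There exist positive constants `C′₄, C′₅, c′₆` such that for
arbitrary functions `V₀, v′, v₁` satisfying (180) with `α₀, α₃, α′₃, α₄, α′₄ ≦ c′₆`, the following bounds hold: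
`|ṽ′⁻¹(c₋)R̄_{0,c}ṽ′(c₊) − 1| < Lα′₄ + C′₄L²(α₀α₄ + α′₃α′₄ + α′₄²)`, (199)  `|ṽ′(y) − 1| < α₄ + C′₅Lα′₄`. (200)"
Kernel form, `V₀ = 1` (so `α₀ = 0`, `R₀ = R̄₀ = id`), all of `ℤ^d` for `Ω`, `≤` for `<`, `ṽ′` in coarse coordinates (`vtil`):
under (180a) `‖v′ − 1‖ ≤ α₄ ≤ 1`, (180b) `‖v′(x)⁻¹v′(x+e_κ) − 1‖ ≤ α′₄`, (180c) `‖v₁ − 1‖ ≤ α₃ ≤ 1/5`, (180d)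
`‖v₁(y)⁻¹v₁(x) − 1‖ ≤ Lα′₃` on blocks, and the smallness `50Lα′₃ ≤ 1`, `10³(d+1)Lα′₄ ≤ 1` (print's `c′₆`, here depending on
`d` and `L`): (199) `‖ṽ′(z)⁻¹ṽ′(z + e_μ) − 1‖ ≤ Lα′₄ + C′₄L²(α′₃α′₄ + α′₄²)` for every coarse bond and (200)
`‖ṽ′(z) − 1‖ ≤ α₄ + C′₅Lα′₄` for every coarse site, with `C′₄ = 10⁴(d+1)²`, `C′₅ = 64(d+1)`.  The conclusions have exactly
the shape of the hypotheses (180a)/(180b) one scale up — the input of the induction of Proposition 10.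
[cite: Balaban1985Averaging, Proposition 9 p.49, (176)–(200) pp.45–49] -/
theorem prop9_flat {L : ℕ} (hL : 1 ≤ L) {v' v₁ : Site d → 𝔸ˣ} {α₃ α₃' α₄ α₄' : ℝ}
    (h4a : SiteBd v' α₄) (h4b : BondBd v' α₄') (h3c : SiteBd v₁ α₃) (h3d : BlockBd L v₁ (L * α₃'))
    (hα₄ : α₄ ≤ 1) (hα₄' : 0 ≤ α₄') (hα₃ : α₃ ≤ 1 / 5) (hα₃' : 50 * (L * α₃') ≤ 1)
    (hs : 1000 * ((d : ℝ) + 1) * L * α₄' ≤ 1) :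
    BondBd (vtil L v' v₁) (L * α₄' + C4' d * L ^ 2 * (α₃' * α₄' + α₄' ^ 2)) ∧
      SiteBd (vtil L v' v₁) (α₄ + C5' d * L * α₄') := by
  obtain ⟨hVA, h4, ha0, ha2, hθ0, hθ1, hθ2⟩ := setup hL h4b hα₄' hs
  have hL' : (1 : ℝ) ≤ L := by exact_mod_cast hL
  have hK : (1 : ℝ) ≤ (d : ℝ) + 1 := by have := Nat.cast_nonneg (α := ℝ) d; linarith
  have hw' : ∀ x, ‖((v₁ x : 𝔸ˣ) : 𝔸) - 1‖ ≤ 2 / 5 := fun x => (h3c x).trans (by linarith)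
  have hw : ∀ x, ‖((((v₁ x)⁻¹ : 𝔸ˣ)) : 𝔸) - 1‖ ≤ 2 / 5 := fun x =>
    (norm_units_inv_sub_one_le (v₁ x) ((h3c x).trans (by linarith))).trans (by linarith [h3c x])
  have hq1 : (L : ℝ) * α₃' ≤ 1 / 50 := by linarith
  have hq0 : 0 ≤ (L : ℝ) * α₃' := (norm_nonneg _).trans (h3d 0 fun _ => ⟨0, hL⟩)
  constructor
  · intro z μ
    have key := core199 hL ha0 hVA hθ0 hθ1 le_rfl hw hw' hq1 ((L : ℤ) • z) μ (fun r => h3d z r)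
      (fun r => by have h := h3d (z + e μ) r; rwa [smul_add] at h)
    rw [vtil_apply, vtil_apply, smul_add]
    calc _ ≤ _ := key
      _ ≤ _ := arith199 hK hL' hα₄' h4 hq0
      _ = _ := by rw [C4']; ring
  · intro z
    have key := core200 hL ha0 hVA hθ0 hθ1 le_rfl hw hw' hq1 hα₄ ((L : ℤ) • z) (fun r => h3d z r) (h4a _)
    rw [vtil_apply]
    have h2 := arith200 hK hL' hα₄' h4 hq1
    calc _ ≤ _ := key
      _ ≤ α₄ + 64 * ((d : ℝ) + 1) * L * α₄' := by linarith
      _ = _ := by rw [C5']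

end Prop9

end Literature.MathematicalPhysics.QuantumFieldTheory.Balaban1983to89.B7Prop9Flat
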